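import Literature.Analysis.FluidPDE.TaoY6LocalRMS
import Mathlib.Analysis.SpecificLimits.Basic
import HarnessLib

/-!
# Tao (2011/2013), proof of Thm. 10.1, the term `Y₆`: the chain bound for the small Whitney balls

Analysis/FluidPDE support file for the discharge of the nonlinear estimate `Y₆` of Tao 2011, §10
(arXiv:1108.1165, proof of Thm. 10.1, p. 33: "The second term of (10.21),
`c^{-0.1}δ²Σᵢrᵢ⁴wᵢ³`, is trickier to handle. Call a ball 'large' if its radius is at least
`10⁻⁴c^{-0.1}δ⁻²` (say), and 'small' otherwise. To deal with the small balls we use the Poincaré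
inequality […] `wᵢ ≤ w_{a(i)} + Σ_{k≥0}|w_{pᵏ(i)} - w_{p^{k+1}(i)}|` […] Taking cubes and using
Hölder's inequality […] Putting the `Y₆,₁` bounds together, we conclude that
`Y₆,₁ ≲ c^{-0.15}δ³W^{3/2} + c^{0.05}δ⁻¹W^{1/2}Y₁`"). For the continuous Whitney family of
`TaoWhitneyKernel` (radius `ρ`, weight `ρ(y)⁻³dy`) Tao's sum `Σᵢ rᵢ⁴wᵢ³` is the integral
`∫ ρ(y) w(y)³ dy` with `w(y) = rmsE ω y ρ(y) = ρ(y)^{-3/2}‖ω‖_{L²(B(y,3ρ(y)))}` (`TaoY6LocalRMS`), and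
this file proves **the chain bound**

* `tao2011_Y6_chain_bound` — with an absolute constant `C`, for `0 < a`, `0 < k`, `a + 2k⁻¹ < b`,
  `u ∈ C²`, `ω = curl u`, `η = annularRamp k a b |· - x₀|`, `W = ½∫|ω|²η`, `Y₁ = ∫|∇ω|²_F η`:
  `∫ ρ(y) w(y)³ dy ≤ C √(2W/(97k)) (k W + k⁻¹ Y₁)`,
  i.e. `k ∫ ρ w³ ≲ k^{3/2}W^{3/2} + k^{-1/2}W^{1/2}Y₁`; the explicit intermediate form is
  `lintegral_chainDensity_le`: `∫ ρ w³ ≤ 217 ∫_{ρ ≥ (400k)⁻¹} ρ w³ + 40804·12996·81 · C_W ∫ Φ`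
  (`C_W = √(2W/(97k))`, `Φ(z) = ρ(z)⁻²∫_{B(z,10ρ(z))}‖Dω‖²`), with the large region and `∫Φ`
  controlled by `lintegral_large_le` and `lintegral_invSq_dissipation_le`.

The parents are the radial moves of `TaoY6ChainGeometry` (`T = radialStep x₀ a λ` on the inner
layer `{0 < |y-x₀| - a < k⁻¹/2}`, `radialStep x₀ b λ` on the outer one, `λ = 103/100`), iterated
until the depth reaches `k⁻¹/2` ("large"); the increments are the one-sided Poincaré bounds of
`TaoY6LocalRMS` (`w(y) ≤ w(Ty) + J(y)`, `J = min(w, 114√D)`, `J³ ≤ 114² w D`); cubes are taken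
with geometric Hölder weights `(101/100)^{2m}` (in place of Tao's `(1+k)^{10}`); Tao's two counting
estimates become the volume comparison `∫_{shell} G(T^m y) dy ≤ λ^{-m}∫_{T^m shell} G` of
`TaoY6RadialChange` together with `ρ(y) = λ^{-m}ρ(T^m y)`; and "the bounded overlap" is the
overlap bound of `TaoWhitneyKernel` (`∫ρ(z)⁻²1[x ∈ B(z,cρ(z))]dz ≲ ρ(x) = η(x)/(100k)`).

## References

* T. Tao, arXiv:1108.1165 (`Tao2011`), §10, proof of Thm. 10.1 (p. 33, from "The second term of
  (10.21)" to "Putting the `Y₆,₁` bounds together").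
-/

noncomputable section

open MeasureTheory Set Function Filter Metric Topology
open scoped ENNReal NNReal

namespace Literature.Analysis.FluidPDE

/-- Local notation for physical space `ℝ³ = EuclideanSpace ℝ (Fin 3)`. -/
local notation "ℝ³" => EuclideanSpace ℝ (Fin 3)

/-! ### Cubes of sums -/

section Cubes

/-- `(x + y)³ ≤ 4x³ + 4y³` in `ℝ≥0∞`. [folklore] -/
theorem y6_add_pow_three_le (x y : ℝ≥0∞) : (x + y) ^ 3 ≤ 4 * x ^ 3 + 4 * y ^ 3 := by
  rcases eq_or_ne x ⊤ with hx | hx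
  · simp [hx]
  rcases eq_or_ne y ⊤ with hy | hy
  · simp [hy]
  lift x to ℝ≥0 using hx
  lift y to ℝ≥0 using hy
  have h : ((x : ℝ≥0) + y) ^ 3 ≤ 4 * x ^ 3 + 4 * y ^ 3 := by
    have hx0 : (0 : ℝ) ≤ x := x.coe_nonneg
    have hy0 : (0 : ℝ) ≤ y := y.coe_nonneg
    rw [← NNReal.coe_le_coe]
    push_cast
    nlinarith [sq_nonneg ((x : ℝ) - y), mul_nonneg hx0 hy0, sq_nonneg ((x : ℝ) + y)]
  exact_mod_cast h

/-- The geometric Hölder weight `s = 101/100` of the chain. [folklore] -/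
def chainWeight : ℝ := 101 / 100

/-- `s = 101/100`. [folklore] -/
theorem chainWeight_eq : chainWeight = 101 / 100 := rfl

/-- `Σ_{m<M} s⁻ᵐ ≤ 101`. [folklore] -/
theorem sum_chainWeight_inv_pow_le (M : ℕ) : ∑ m ∈ Finset.range M, chainWeight⁻¹ ^ m ≤ 101 := by
  have h0 : 0 ≤ chainWeight⁻¹ := by rw [chainWeight_eq]; norm_num
  have h1 : chainWeight⁻¹ < 1 := by rw [chainWeight_eq]; norm_num
  have hs : Summable fun m : ℕ => chainWeight⁻¹ ^ m := summable_geometric_of_lt_one h0 h1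
  calc ∑ m ∈ Finset.range M, chainWeight⁻¹ ^ m ≤ ∑' m : ℕ, chainWeight⁻¹ ^ m :=
        hs.sum_le_tsum (Finset.range M) fun m _ => pow_nonneg h0 m
    _ = (1 - chainWeight⁻¹)⁻¹ := tsum_geometric_of_lt_one h0 h1
    _ = 101 := by rw [chainWeight_eq]; norm_num

/-- **Cubing a finite sum with geometric Hölder weights**:
`(Σ_{m<M} a_m)³ ≤ 101² Σ_{m<M} s^{2m} a_m³`, `s = 101/100`
(Hölder `Σ a = Σ s^{-2m/3}·(s^{2m/3}a)` with exponents `(3/2, 3)` and `Σ s^{-m} ≤ 101`). [cite: Tao2011, §10, proof of Thm. 10.1 (p. 33, "Taking cubes and using Hölder's inequality")] -/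
theorem cube_sum_le_weighted (a : ℕ → ℝ≥0∞) (M : ℕ) :
    (∑ m ∈ Finset.range M, a m) ^ 3 ≤
      10201 * ∑ m ∈ Finset.range M, ENNReal.ofReal (chainWeight ^ (2 * m)) * a m ^ 3 := by
  have hs0 : 0 < chainWeight := by rw [chainWeight_eq]; norm_num
  have h32 : (3 / 2 : ℝ).HolderConjugate 3 := by rw [Real.holderConjugate_iff]; norm_num
  set f : ℕ → ℝ≥0∞ := fun m => ENNReal.ofReal (chainWeight⁻¹ ^ m) ^ (2 / 3 : ℝ) with hf
  set g : ℕ → ℝ≥0∞ := fun m => ENNReal.ofReal (chainWeight ^ m) ^ (2 / 3 : ℝ) * a m with hg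
  -- `f g = a`
  have hfg : ∀ m, f m * g m = a m := fun m => by
    rw [hf, hg, ← mul_assoc, ← ENNReal.mul_rpow_of_nonneg _ _ (by norm_num),
      ← ENNReal.ofReal_mul (by positivity), ← mul_pow, inv_mul_cancel₀ hs0.ne', one_pow,
      ENNReal.ofReal_one, ENNReal.one_rpow, one_mul]
  -- `f^{3/2} = s^{-m}`, `g³ = s^{2m} a³`
  have hf32 : ∀ m, f m ^ (3 / 2 : ℝ) = ENNReal.ofReal (chainWeight⁻¹ ^ m) := fun m => by
    rw [hf, ← ENNReal.rpow_mul]; norm_num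
  have hg3 : ∀ m, g m ^ (3 : ℝ) = ENNReal.ofReal (chainWeight ^ (2 * m)) * a m ^ 3 := fun m => by
    rw [hg, ENNReal.mul_rpow_of_nonneg _ _ (by norm_num), ← ENNReal.rpow_mul,
      show (2 / 3 : ℝ) * 3 = 2 by norm_num, ENNReal.rpow_two, ← ENNReal.ofReal_pow (by positivity),
      ← pow_mul, mul_comm m 2, show ((3 : ℝ)) = ((3 : ℕ) : ℝ) by norm_num, ENNReal.rpow_natCast]
  have hH := ENNReal.inner_le_Lp_mul_Lq (s := Finset.range M) f g h32
  simp only [hfg, hf32, hg3] at hH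
  -- the weight sum
  have hw : (∑ m ∈ Finset.range M, ENNReal.ofReal (chainWeight⁻¹ ^ m)) ≤ 101 := by
    rw [← ENNReal.ofReal_sum_of_nonneg (fun m _ => by positivity)]
    rw [show (101 : ℝ≥0∞) = ENNReal.ofReal 101 by norm_num]
    exact ENNReal.ofReal_le_ofReal (sum_chainWeight_inv_pow_le M)
  -- cube the Hölder inequality
  calc (∑ m ∈ Finset.range M, a m) ^ 3
      ≤ ((∑ m ∈ Finset.range M, ENNReal.ofReal (chainWeight⁻¹ ^ m)) ^ (1 / (3 / 2 : ℝ)) *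
          (∑ m ∈ Finset.range M, ENNReal.ofReal (chainWeight ^ (2 * m)) * a m ^ 3) ^ (1 / (3 : ℝ))) ^ 3 := by
        gcongr
    _ = (∑ m ∈ Finset.range M, ENNReal.ofReal (chainWeight⁻¹ ^ m)) ^ 2 *
          ∑ m ∈ Finset.range M, ENNReal.ofReal (chainWeight ^ (2 * m)) * a m ^ 3 := by
        rw [mul_pow, ← ENNReal.rpow_natCast, ← ENNReal.rpow_natCast, ← ENNReal.rpow_mul, ← ENNReal.rpow_mul]
        norm_num
    _ ≤ 101 ^ 2 * ∑ m ∈ Finset.range M, ENNReal.ofReal (chainWeight ^ (2 * m)) * a m ^ 3 := by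
        gcongr
    _ = 10201 * ∑ m ∈ Finset.range M, ENNReal.ofReal (chainWeight ^ (2 * m)) * a m ^ 3 := by norm_num

/-- **`J³ ≤ 114² w D`** for `J = min(w, 114 √D)`: `J³ = J · J²`, `J ≤ w`, `J² ≤ 114² D`. [cite: Tao2011, §10, proof of Thm. 10.1 (p. 33, "From (10.23) (once) and (10.22) (twice)")] -/
theorem min_pow_three_le (w D : ℝ≥0∞) :
    min w (114 * D ^ (1 / 2 : ℝ)) ^ 3 ≤ 12996 * w * D := by
  set J := min w (114 * D ^ (1 / 2 : ℝ)) with hJ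
  have h1 : J ≤ w := min_le_left _ _
  have hD : (D ^ (1 / 2 : ℝ)) ^ 2 = D := by
    rw [← ENNReal.rpow_two, ← ENNReal.rpow_mul]; norm_num
  have h2 : J ^ 2 ≤ 12996 * D := by
    calc J ^ 2 ≤ (114 * D ^ (1 / 2 : ℝ)) ^ 2 := pow_le_pow_left' (min_le_right _ _) 2
      _ = 12996 * D := by rw [mul_pow, hD]; norm_num
  calc J ^ 3 = J * J ^ 2 := by ring
    _ ≤ w * (12996 * D) := mul_le_mul' h1 h2
    _ = 12996 * w * D := by ring

end Cubes

/-! ### The overlap bounds, integrated -/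

section Overlap

variable {x₀ : ℝ³} {a b k : ℝ}

/-- **Integrated overlap bound**: for measurable `g ≥ 0` and `0 ≤ c < 100`,
`∫ ρ(z)⁻² (∫_{B(z,cρ(z))} g) dz ≤ C_c vol B(0,1) ∫ g(x) ρ(x) dx`,
`C_c = (1+c/100)²(c/(1−c/100))³` (Tonelli and `lintegral_whitneyKernel_two_le`). [cite: Tao2011, §10, proof of Thm. 10.1 ("by (10.20) and the bounded overlap")] -/
theorem lintegral_invSq_mul_setLIntegral_ball_le {g : ℝ³ → ℝ≥0∞} (hg : Measurable g) {c : ℝ}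
    (hc0 : 0 ≤ c) (hc : c < 100) :
    ∫⁻ z, ENNReal.ofReal ((whitneyRadius x₀ a b k z)⁻¹ ^ 2) *
        ∫⁻ x in ball z (c * whitneyRadius x₀ a b k z), g x ≤
      ENNReal.ofReal ((1 + c / 100) ^ 2 * (c / (1 - c / 100)) ^ 3) * volume (ball (0 : ℝ³) 1) *
        ∫⁻ x, g x * ENNReal.ofReal (whitneyRadius x₀ a b k x) := by
  have hKm : Measurable (uncurry fun x z => whitneyKernel x₀ a b k c 2 z x * g x) := by
    have e : (uncurry fun x z => whitneyKernel x₀ a b k c 2 z x * g x) =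
        fun p : ℝ³ × ℝ³ => uncurry (whitneyKernel x₀ a b k c 2) (p.2, p.1) * g p.1 := rfl
    rw [e]
    exact ((measurable_whitneyKernel x₀ a b k c 2).comp measurable_swap).mul (hg.comp measurable_fst)
  calc ∫⁻ z, ENNReal.ofReal ((whitneyRadius x₀ a b k z)⁻¹ ^ 2) *
          ∫⁻ x in ball z (c * whitneyRadius x₀ a b k z), g x
      = ∫⁻ z, ∫⁻ x, whitneyKernel x₀ a b k c 2 z x * g x :=
        lintegral_congr fun z => (lintegral_whitneyKernel_mul x₀ a b k c 2 z g).symm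
    _ = ∫⁻ x, ∫⁻ z, whitneyKernel x₀ a b k c 2 z x * g x := (lintegral_lintegral_swap hKm.aemeasurable).symm
    _ = ∫⁻ x, g x * ∫⁻ z, whitneyKernel x₀ a b k c 2 z x := by
        refine lintegral_congr fun x => ?_
        rw [lintegral_mul_const _ (measurable_whitneyKernel_left x₀ a b k c 2 x), mul_comm]
    _ ≤ ∫⁻ x, g x * (ENNReal.ofReal ((1 + c / 100) ^ 2 * (c / (1 - c / 100)) ^ 3 * whitneyRadius x₀ a b k x) *
          volume (ball (0 : ℝ³) 1)) :=
        lintegral_mono fun x => mul_le_mul' le_rfl (lintegral_whitneyKernel_two_le hc0 hc x)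
    _ = ENNReal.ofReal ((1 + c / 100) ^ 2 * (c / (1 - c / 100)) ^ 3) * volume (ball (0 : ℝ³) 1) *
          ∫⁻ x, g x * ENNReal.ofReal (whitneyRadius x₀ a b k x) := by
        rw [← lintegral_const_mul' _ _ (ENNReal.mul_ne_top ENNReal.ofReal_ne_top measure_ball_lt_top.ne)]
        refine lintegral_congr fun x => ?_
        have h0 : 0 ≤ (1 + c / 100) ^ 2 * (c / (1 - c / 100)) ^ 3 := by
          have : 0 < 1 - c / 100 := by linarith
          positivity
        rw [ENNReal.ofReal_mul h0]
        ring

/-- `ρ = η/(100k)` under `ofReal`: `ofReal ρ(x) = ofReal (100k)⁻¹ · ofReal η(x)` (`k > 0`). [folklore] -/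
theorem ofReal_whitneyRadius_eq (hk : 0 < k) (x : ℝ³) :
    ENNReal.ofReal (whitneyRadius x₀ a b k x) =
      ENNReal.ofReal (100 * k)⁻¹ * ENNReal.ofReal (annularRamp k a b ‖x - x₀‖) := by
  rw [annularRamp_eq_mul_whitneyRadius' hk x, ← ENNReal.ofReal_mul (by positivity)]
  congr 1
  field_simp

/-- **The dissipation through the overlap bound**:
`∫ ρ(z)⁻² (∫_{B(z,10ρ(z))} ‖Dω‖²) dz ≤ (C₁₀ vol B(0,1)/(100k)) · Y₁`, `Y₁ = ∫|∇ω|²_F η`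
(operator norm `≤` Frobenius norm). [cite: Tao2011, §10, proof of Thm. 10.1 ((10.20): "Σⱼ rⱼ∫_{10Bⱼ}|∇ω|² ≲ c^{0.1}δ⁻²∫|∇ω|²η")] -/
theorem lintegral_invSq_dissipation_le (hk : 0 < k) {u : ℝ³ → ℝ³} (hu : ContDiff ℝ 2 u) :
    ∫⁻ z, ENNReal.ofReal ((whitneyRadius x₀ a b k z)⁻¹ ^ 2) *
        ∫⁻ x in ball z (10 * whitneyRadius x₀ a b k z), ‖fderiv ℝ (curl u) x‖ₑ ^ 2 ≤
      ENNReal.ofReal ((1 + 10 / 100) ^ 2 * (10 / (1 - 10 / 100)) ^ 3) * volume (ball (0 : ℝ³) 1) *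
        ENNReal.ofReal (100 * k)⁻¹ *
          ENNReal.ofReal (localisedEnstrophyDissipation (fun x => annularRamp k a b ‖x - x₀‖) u) := by
  have hω1 : ContDiff ℝ 1 (curl u) := contDiff_curl (n := 1) hu
  have hDc : Continuous fun x => fderiv ℝ (curl u) x := hω1.continuous_fderiv one_ne_zero
  have hg : Measurable fun x => ‖fderiv ℝ (curl u) x‖ₑ ^ 2 := hDc.enorm.measurable.pow_const 2
  refine (lintegral_invSq_mul_setLIntegral_ball_le (x₀ := x₀) (a := a) (b := b) (k := k) hg
    (by norm_num) (by norm_num)).trans ?_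
  rw [mul_assoc (ENNReal.ofReal _ * volume (ball (0 : ℝ³) 1))]
  gcongr
  -- `∫ ‖Dω‖² ρ ≤ (100k)⁻¹ Y₁`
  have hF : ∀ x, ‖fderiv ℝ (curl u) x‖ₑ ^ 2 ≤ ENNReal.ofReal (frobeniusNormSq (fderiv ℝ (curl u) x)) := fun x => by
    rw [← ofReal_norm, ← ENNReal.ofReal_pow (norm_nonneg _)]
    exact ENNReal.ofReal_le_ofReal (sq_opNorm_le_frobeniusNormSq _)
  have hcont : Continuous fun x => frobeniusNormSq (fderiv ℝ (curl u) x) * annularRamp k a b ‖x - x₀‖ :=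
    (continuous_frobeniusNormSq_fderiv hω1 one_ne_zero).mul
      ((continuous_annularRamp hk.le a b).comp (continuous_id.sub continuous_const).norm)
  have hint : Integrable fun x => frobeniusNormSq (fderiv ℝ (curl u) x) * annularRamp k a b ‖x - x₀‖ :=
    integrable_mul_annularRamp hk.le (continuous_frobeniusNormSq_fderiv hω1 one_ne_zero)
  calc ∫⁻ x, ‖fderiv ℝ (curl u) x‖ₑ ^ 2 * ENNReal.ofReal (whitneyRadius x₀ a b k x)
      ≤ ∫⁻ x, ENNReal.ofReal (frobeniusNormSq (fderiv ℝ (curl u) x)) *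
          (ENNReal.ofReal (100 * k)⁻¹ * ENNReal.ofReal (annularRamp k a b ‖x - x₀‖)) :=
        lintegral_mono fun x => by rw [← ofReal_whitneyRadius_eq hk x]; exact mul_le_mul' (hF x) le_rfl
    _ = ENNReal.ofReal (100 * k)⁻¹ *
          ∫⁻ x, ENNReal.ofReal (frobeniusNormSq (fderiv ℝ (curl u) x) * annularRamp k a b ‖x - x₀‖) := by
        rw [← lintegral_const_mul' _ _ ENNReal.ofReal_ne_top]
        refine lintegral_congr fun x => ?_
        rw [ENNReal.ofReal_mul (frobeniusNormSq_nonneg _)]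
        ring
    _ = ENNReal.ofReal (100 * k)⁻¹ *
          ENNReal.ofReal (localisedEnstrophyDissipation (fun x => annularRamp k a b ‖x - x₀‖) u) := by
        rw [localisedEnstrophyDissipation_def, ofReal_integral_eq_lintegral_ofReal hint
          (Eventually.of_forall fun x => mul_nonneg (frobeniusNormSq_nonneg _) (annularRamp_nonneg _ _ _ _))]

/-- **The local masses through the overlap bound**:
`∫ ρ(z)⁻² (∫_{B(z,3ρ(z))} |ω|²) dz ≤ (C₃ vol B(0,1)/(100k)) · 2W`, `W = ½∫|ω|²η`. [cite: Tao2011, §10, proof of Thm. 10.1 ((10.22): "Σᵢ rᵢ⁴wᵢ² ≲ c^{0.1}δ⁻²W")] -/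
theorem lintegral_invSq_mass_le (hk : 0 < k) {u : ℝ³ → ℝ³} (hω : Continuous (curl u)) :
    ∫⁻ z, ENNReal.ofReal ((whitneyRadius x₀ a b k z)⁻¹ ^ 2) *
        ∫⁻ x in ball z (3 * whitneyRadius x₀ a b k z), ‖curl u x‖ₑ ^ 2 ≤
      ENNReal.ofReal ((1 + 3 / 100) ^ 2 * (3 / (1 - 3 / 100)) ^ 3) * volume (ball (0 : ℝ³) 1) *
        ENNReal.ofReal (100 * k)⁻¹ *
          ENNReal.ofReal (2 * localisedEnstrophy (fun x => annularRamp k a b ‖x - x₀‖) u) := by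
  have hg : Measurable fun x => ‖curl u x‖ₑ ^ 2 := hω.enorm.measurable.pow_const 2
  refine (lintegral_invSq_mul_setLIntegral_ball_le (x₀ := x₀) (a := a) (b := b) (k := k) hg
    (by norm_num) (by norm_num)).trans ?_
  rw [mul_assoc (ENNReal.ofReal _ * volume (ball (0 : ℝ³) 1))]
  refine mul_le_mul' le_rfl (le_of_eq ?_)
  have hcont : Continuous fun x => ‖curl u x‖ ^ 2 * annularRamp k a b ‖x - x₀‖ :=
    (hω.norm.pow 2).mul ((continuous_annularRamp hk.le a b).comp (continuous_id.sub continuous_const).norm)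
  have hint : Integrable fun x => ‖curl u x‖ ^ 2 * annularRamp k a b ‖x - x₀‖ :=
    integrable_mul_annularRamp hk.le (hω.norm.pow 2)
  calc ∫⁻ x, ‖curl u x‖ₑ ^ 2 * ENNReal.ofReal (whitneyRadius x₀ a b k x)
      = ∫⁻ x, ENNReal.ofReal (‖curl u x‖ ^ 2) *
          (ENNReal.ofReal (100 * k)⁻¹ * ENNReal.ofReal (annularRamp k a b ‖x - x₀‖)) :=
        lintegral_congr fun x => by
          rw [← ofReal_whitneyRadius_eq hk x, ← ofReal_norm, ENNReal.ofReal_pow (norm_nonneg _)]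
    _ = ENNReal.ofReal (100 * k)⁻¹ *
          ∫⁻ x, ENNReal.ofReal (‖curl u x‖ ^ 2 * annularRamp k a b ‖x - x₀‖) := by
        rw [← lintegral_const_mul' _ _ ENNReal.ofReal_ne_top]
        refine lintegral_congr fun x => ?_
        rw [ENNReal.ofReal_mul (sq_nonneg _)]
        ring
    _ = ENNReal.ofReal (100 * k)⁻¹ *
          ENNReal.ofReal (2 * localisedEnstrophy (fun x => annularRamp k a b ‖x - x₀‖) u) := by
        rw [localisedEnstrophy_def,
          show (2 : ℝ) * (1 / 2 * ∫ x, ‖curl u x‖ ^ 2 * annularRamp k a b ‖x - x₀‖) =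
            ∫ x, ‖curl u x‖ ^ 2 * annularRamp k a b ‖x - x₀‖ by ring,
          ofReal_integral_eq_lintegral_ofReal hint
            (Eventually.of_forall fun x => mul_nonneg (sq_nonneg _) (annularRamp_nonneg _ _ _ _))]

end Overlap

/-! ### The inner chain: iterated parent moves and the telescoping bound -/

section InnerChain

variable {x₀ : ℝ³} {a b k : ℝ}

/-- The step map with factor `1` is the identity. [folklore] -/
theorem radialStep_factor_one (x₀ : ℝ³) (p : ℝ) (y : ℝ³) : radialStep x₀ p 1 y = y := by
  by_cases hy : y = x₀
  · subst hy; simp [radialStep_apply]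
  · have hr : 0 < ‖y - x₀‖ := norm_pos_iff.2 (sub_ne_zero.2 hy)
    rw [radialStep_apply, one_mul, add_sub_cancel, smul_smul, mul_inv_cancel₀ hr.ne', one_smul,
      add_sub_cancel]

/-- The increment `J(z) = min(w(z), 114 √D(z))` of the chain at the point `z` (radius `ρ(z)`).
[cite: Tao2011, §10, proof of Thm. 10.1 (p. 33, the increments |w_{pᵏ(i)} − w_{pᵏ⁺¹(i)}|)] -/
def chainIncr (x₀ : ℝ³) (a b k : ℝ) (ω : ℝ³ → ℝ³) (z : ℝ³) : ℝ≥0∞ :=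
  min (rmsE ω z (whitneyRadius x₀ a b k z))
    (114 * dissE ω z (whitneyRadius x₀ a b k z) ^ (1 / 2 : ℝ))

/-- Unfolding `chainIncr`. [folklore] -/
theorem chainIncr_def (x₀ : ℝ³) (a b k : ℝ) (ω : ℝ³ → ℝ³) (z : ℝ³) :
    chainIncr x₀ a b k ω z = min (rmsE ω z (whitneyRadius x₀ a b k z))
      (114 * dissE ω z (whitneyRadius x₀ a b k z) ^ (1 / 2 : ℝ)) := rfl

/-- **One step of the inner chain**: for `ω ∈ C¹`, `0 < a`, `a + 2k⁻¹ < b`, and a point `y` of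
the inner layer with `0 < |y - x₀| - a < k⁻¹/2`:
`w(y) ≤ w(T y) + J(y)`, `T = radialStep x₀ a λ` (the one-sided Poincaré increment at the parent
move). [cite: Tao2011, §10, proof of Thm. 10.1 (p. 33)] -/
theorem rmsE_le_rmsE_innerStep_add (ha : 0 < a) (hk : 0 < k) (hab : a + 2 * k⁻¹ < b)
    {ω : ℝ³ → ℝ³} (hω : ContDiff ℝ 1 ω) {y : ℝ³} (hy : a < ‖y - x₀‖)
    (hsmall : ‖y - x₀‖ - a < k⁻¹ / 2) :
    rmsE ω y (whitneyRadius x₀ a b k y) ≤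
      rmsE ω (radialStep x₀ a chainFactor y) (whitneyRadius x₀ a b k (radialStep x₀ a chainFactor y)) +
        chainIncr x₀ a b k ω y := by
  have hℓ : 0 < k⁻¹ := inv_pos.2 hk
  have ht0 : 0 < ‖y - x₀‖ - a := by linarith
  have hlam := one_lt_chainFactor
  have h1 : chainFactor * (‖y - x₀‖ - a) ≤ (b - a) / 2 := by
    rw [chainFactor_eq]; nlinarith
  have h2 : chainFactor * (‖y - x₀‖ - a) ≤ k⁻¹ := by
    rw [chainFactor_eq]; nlinarith
  obtain ⟨hρT, hdT⟩ := inner_parent (k := k) ha.le hy h1 h2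
  have hd : 0 < annDepth x₀ a b y := by
    rw [annDepth_eq_inner (by linarith)]; exact ht0
  have hρ : 0 < whitneyRadius x₀ a b k y := whitneyRadius_pos hk hd
  have hP := rmsE_le_rmsE_parent_add hω hρ hρT hdT
  rw [chainIncr_def]
  rcases le_total (rmsE ω y (whitneyRadius x₀ a b k y))
      (114 * dissE ω y (whitneyRadius x₀ a b k y) ^ (1 / 2 : ℝ)) with h | h
  · rw [min_eq_left h]; exact le_add_self
  · rw [min_eq_right h]; exact hP

/-- **The telescoping bound of the inner chain**: for `y` on the inner layer and `n` such that
all the points `T^m y`, `m < n`, are still small (`λᵐ(|y - x₀| - a) < k⁻¹/2`),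
`w(y) ≤ w(T^n y) + Σ_{m<n} J(T^m y)`, `T^m = radialStep x₀ a λᵐ`
(Tao: "`wᵢ ≤ w_{a(i)} + Σ_{k≥0}|w_{pᵏ(i)} - w_{pᵏ⁺¹(i)}|`"). [cite: Tao2011, §10, proof of Thm. 10.1 (p. 33)] -/
theorem rmsE_le_rmsE_iterate_add_sum (ha : 0 < a) (hk : 0 < k) (hab : a + 2 * k⁻¹ < b)
    {ω : ℝ³ → ℝ³} (hω : ContDiff ℝ 1 ω) {y : ℝ³} (hy : a < ‖y - x₀‖) (n : ℕ)
    (hn : ∀ m < n, chainFactor ^ m * (‖y - x₀‖ - a) < k⁻¹ / 2) :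
    rmsE ω y (whitneyRadius x₀ a b k y) ≤
      rmsE ω (radialStep x₀ a (chainFactor ^ n) y) (whitneyRadius x₀ a b k (radialStep x₀ a (chainFactor ^ n) y)) +
        ∑ m ∈ Finset.range n, chainIncr x₀ a b k ω (radialStep x₀ a (chainFactor ^ m) y) := by
  have hy0 : y ≠ x₀ := by intro h; rw [h, sub_self, norm_zero] at hy; linarith
  have ht0 : 0 < ‖y - x₀‖ - a := by linarith
  induction n with
  | zero => simp [radialStep_factor_one]
  | succ n ih =>
    have hn' : ∀ m < n, chainFactor ^ m * (‖y - x₀‖ - a) < k⁻¹ / 2 := fun m hm => hn m (Nat.lt_succ_of_lt hm)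
    have h0 := ih hn'
    -- the point `y' = T^n y`
    set y' := radialStep x₀ a (chainFactor ^ n) y with hy'
    have hpow : 0 ≤ chainFactor ^ n := pow_nonneg chainFactor_pos.le n
    have hdep : ‖y' - x₀‖ - a = chainFactor ^ n * (‖y - x₀‖ - a) := inner_depth_radialStep ha.le hpow hy
    have hy'in : a < ‖y' - x₀‖ := by
      have : 0 < chainFactor ^ n * (‖y - x₀‖ - a) := mul_pos (pow_pos chainFactor_pos n) ht0
      linarith
    have hy'small : ‖y' - x₀‖ - a < k⁻¹ / 2 := by rw [hdep]; exact hn n (Nat.lt_succ_self n)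
    have hstep := rmsE_le_rmsE_innerStep_add (b := b) ha hk hab hω hy'in hy'small
    -- `T y' = T^{n+1} y`
    have hcomp : radialStep x₀ a chainFactor y' = radialStep x₀ a (chainFactor ^ (n + 1)) y := by
      rw [hy', radialStep_radialStep hy0, pow_succ, mul_comm]
      have : 0 < chainFactor ^ n * (‖y - x₀‖ - a) := mul_pos (pow_pos chainFactor_pos n) ht0
      linarith
    rw [hcomp] at hstep
    calc rmsE ω y (whitneyRadius x₀ a b k y)
        ≤ rmsE ω y' (whitneyRadius x₀ a b k y') +
            ∑ m ∈ Finset.range n, chainIncr x₀ a b k ω (radialStep x₀ a (chainFactor ^ m) y) := h0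
      _ ≤ (rmsE ω (radialStep x₀ a (chainFactor ^ (n + 1)) y)
              (whitneyRadius x₀ a b k (radialStep x₀ a (chainFactor ^ (n + 1)) y)) + chainIncr x₀ a b k ω y') +
            ∑ m ∈ Finset.range n, chainIncr x₀ a b k ω (radialStep x₀ a (chainFactor ^ m) y) := by
          gcongr
      _ = _ := by rw [Finset.sum_range_succ, hy']; ring

end InnerChain

/-! ### The large balls -/

section Large

variable {x₀ : ℝ³} {a b k : ℝ}

/-- The constant `C_W = √(2W/(97k))` of (10.23). [folklore] -/
def bongConst (k W : ℝ) : ℝ := Real.sqrt (2 * W / (97 * k))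

/-- **The large balls** (`ρ(y) ≥ (400k)⁻¹`, which contains Tao's large balls and the first shell
above the small layers): `∫_{ρ ≥ (400k)⁻¹} ρ w³ ≤ C_W (400k)² · C₃|B(0,1)| (100k)⁻¹ · 2W`
("`c^{-0.1}δ²Σᵢrᵢ⁴w_{a(i)}³ ≲ c^{-0.25}δ⁵W^{1/2}Σⱼrⱼ⁴wⱼ² ≲ c^{-0.15}δ³W^{3/2}`"). [cite: Tao2011, §10, proof of Thm. 10.1 (p. 33, the large balls)] -/
theorem lintegral_large_le (hk : 0 < k) {u : ℝ³ → ℝ³} (hω : Continuous (curl u)) :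
    ∫⁻ y in {y | (400 * k)⁻¹ ≤ whitneyRadius x₀ a b k y},
        ENNReal.ofReal (whitneyRadius x₀ a b k y) * rmsE (curl u) y (whitneyRadius x₀ a b k y) ^ 3 ≤
      ENNReal.ofReal (bongConst k (localisedEnstrophy (fun x => annularRamp k a b ‖x - x₀‖) u) * (400 * k) ^ 2) *
        (ENNReal.ofReal ((1 + 3 / 100) ^ 2 * (3 / (1 - 3 / 100)) ^ 3) * volume (ball (0 : ℝ³) 1) *
          ENNReal.ofReal (100 * k)⁻¹ *
            ENNReal.ofReal (2 * localisedEnstrophy (fun x => annularRamp k a b ‖x - x₀‖) u)) := by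
  set ρ := whitneyRadius x₀ a b k with hρ
  set W := localisedEnstrophy (fun x => annularRamp k a b ‖x - x₀‖) u with hW
  have hW0 : 0 ≤ W := localisedEnstrophy_nonneg (fun x => annularRamp_nonneg _ _ _ _) u
  set L : Set ℝ³ := {y | (400 * k)⁻¹ ≤ ρ y} with hL
  have hLm : MeasurableSet L := (isClosed_le continuous_const (continuous_whitneyRadius x₀ a b k)).measurableSet
  -- pointwise on `L`: `ρ w³ ≤ C_W (400k)² · ρ⁻² ∫_{B(y,3ρ)} |ω|²`
  have hpt : ∀ y ∈ L, ENNReal.ofReal (ρ y) * rmsE (curl u) y (ρ y) ^ 3 ≤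
      ENNReal.ofReal (bongConst k W * (400 * k) ^ 2) *
        (ENNReal.ofReal ((ρ y)⁻¹ ^ 2) * ∫⁻ z in ball y (3 * ρ y), ‖curl u z‖ₑ ^ 2) := by
    intro y hy
    have hρ0 : 0 < ρ y := lt_of_lt_of_le (by positivity) hy
    have hd : 0 < annDepth x₀ a b y := by
      by_contra h
      push Not at h
      have := whitneyRadius_eq_zero (k := k) h
      rw [← hρ] at this; linarith
    have hb := rmsE_whitney_le (x₀ := x₀) (a := a) (b := b) hk hω hd
    rw [← hρ, ← hW] at hb
    -- `w ≤ C_W ρ⁻² ≤ C_W (400k)²`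
    have hsup : rmsE (curl u) y (ρ y) ≤ ENNReal.ofReal (bongConst k W * (400 * k) ^ 2) := by
      refine hb.trans (ENNReal.ofReal_le_ofReal ?_)
      rw [bongConst]
      refine mul_le_mul_of_nonneg_left ?_ (Real.sqrt_nonneg _)
      have hinv : (ρ y)⁻¹ ≤ 400 * k := by
        have := (inv_le_inv₀ hρ0 (by positivity : (0:ℝ) < (400 * k)⁻¹)).2 hy
        rwa [inv_inv] at this
      exact pow_le_pow_left₀ (inv_nonneg.2 hρ0.le) hinv 2
    calc ENNReal.ofReal (ρ y) * rmsE (curl u) y (ρ y) ^ 3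
        = rmsE (curl u) y (ρ y) * (ENNReal.ofReal (ρ y) * rmsE (curl u) y (ρ y) ^ 2) := by ring
      _ ≤ ENNReal.ofReal (bongConst k W * (400 * k) ^ 2) *
            (ENNReal.ofReal (ρ y) * rmsE (curl u) y (ρ y) ^ 2) := mul_le_mul' hsup le_rfl
      _ = ENNReal.ofReal (bongConst k W * (400 * k) ^ 2) *
            (ENNReal.ofReal ((ρ y)⁻¹ ^ 2) * ∫⁻ z in ball y (3 * ρ y), ‖curl u z‖ₑ ^ 2) := by
          rw [rmsE_sq, ← mul_assoc (ENNReal.ofReal (ρ y)), ← ENNReal.ofReal_mul hρ0.le]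
          congr 3
          field_simp
  calc ∫⁻ y in L, ENNReal.ofReal (ρ y) * rmsE (curl u) y (ρ y) ^ 3
      ≤ ∫⁻ y in L, ENNReal.ofReal (bongConst k W * (400 * k) ^ 2) *
          (ENNReal.ofReal ((ρ y)⁻¹ ^ 2) * ∫⁻ z in ball y (3 * ρ y), ‖curl u z‖ₑ ^ 2) :=
        setLIntegral_mono' hLm hpt
    _ ≤ ∫⁻ y, ENNReal.ofReal (bongConst k W * (400 * k) ^ 2) *
          (ENNReal.ofReal ((ρ y)⁻¹ ^ 2) * ∫⁻ z in ball y (3 * ρ y), ‖curl u z‖ₑ ^ 2) :=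
        setLIntegral_le_lintegral _ _
    _ = ENNReal.ofReal (bongConst k W * (400 * k) ^ 2) *
          ∫⁻ y, ENNReal.ofReal ((ρ y)⁻¹ ^ 2) * ∫⁻ z in ball y (3 * ρ y), ‖curl u z‖ₑ ^ 2 :=
        lintegral_const_mul' _ _ ENNReal.ofReal_ne_top
    _ ≤ _ := mul_le_mul' le_rfl (lintegral_invSq_mass_le hk hω)

end Large

/-! ### The inner layer: the iterates stay in the linear regime -/

section InnerIterates

variable {x₀ : ℝ³} {a b k : ℝ}

/-- **The iterate `T^m y` of a point of the inner layer, in the linear regime**: if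
`0 < t = |y - x₀| - a` and `λᵐ t < k⁻¹` (`a + 2k⁻¹ < b`), then `z = radialStep x₀ a λᵐ y` lies in the open annulus with
`d(z) = λᵐ t`, `ρ(z) = λᵐ t/100` and `ρ(y) = λ⁻ᵐ ρ(z)`. [folklore] -/
theorem inner_iterate (ha : 0 < a) (hk : 0 < k) (hab : a + 2 * k⁻¹ < b) {y : ℝ³} (hy : a < ‖y - x₀‖)
    (m : ℕ) (hm : chainFactor ^ m * (‖y - x₀‖ - a) < k⁻¹) :
    0 < annDepth x₀ a b (radialStep x₀ a (chainFactor ^ m) y) ∧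
      whitneyRadius x₀ a b k (radialStep x₀ a (chainFactor ^ m) y) = chainFactor ^ m * (‖y - x₀‖ - a) / 100 ∧
      whitneyRadius x₀ a b k y = (chainFactor ^ m)⁻¹ * whitneyRadius x₀ a b k (radialStep x₀ a (chainFactor ^ m) y) := by
  have hℓ : 0 < k⁻¹ := inv_pos.2 hk
  have ht0 : 0 < ‖y - x₀‖ - a := by linarith
  have hpow : 0 < chainFactor ^ m := pow_pos chainFactor_pos m
  have hpow1 : 1 ≤ chainFactor ^ m := one_le_pow₀ one_le_chainFactor
  have hdep : ‖radialStep x₀ a (chainFactor ^ m) y - x₀‖ - a = chainFactor ^ m * (‖y - x₀‖ - a) :=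
    inner_depth_radialStep ha.le hpow.le hy
  have htm : 0 < chainFactor ^ m * (‖y - x₀‖ - a) := mul_pos hpow ht0
  have ht1 : ‖y - x₀‖ - a < k⁻¹ := lt_of_le_of_lt (le_mul_of_one_le_left ht0.le hpow1) hm
  have hd : annDepth x₀ a b (radialStep x₀ a (chainFactor ^ m) y) = chainFactor ^ m * (‖y - x₀‖ - a) := by
    rw [annDepth_eq_inner (by rw [hdep]; linarith), hdep]
  have h0 : 0 ≤ ‖radialStep x₀ a (chainFactor ^ m) y - x₀‖ - a := by rw [hdep]; exact htm.le
  have h1 : ‖radialStep x₀ a (chainFactor ^ m) y - x₀‖ - a ≤ (b - a) / 2 := by rw [hdep]; linarith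
  have h2 : ‖radialStep x₀ a (chainFactor ^ m) y - x₀‖ - a ≤ k⁻¹ := by rw [hdep]; linarith
  have hρT : whitneyRadius x₀ a b k (radialStep x₀ a (chainFactor ^ m) y) =
      chainFactor ^ m * (‖y - x₀‖ - a) / 100 := by
    rw [whitneyRadius_eq_inner h0 h1 h2, hdep]
  refine ⟨by rw [hd]; exact htm, hρT, ?_⟩
  rw [hρT, whitneyRadius_eq_inner ht0.le (by linarith) (by linarith)]
  field_simp

end InnerIterates

/-! ### The inner layer, term B: the increments -/

section InnerB

variable {x₀ : ℝ³} {a b k : ℝ}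

/-- The overlap integrand `Φ(z) = ρ(z)⁻² ∫_{B(z,10ρ(z))} ‖Dω‖²`. [folklore] -/
def dissOverlap (x₀ : ℝ³) (a b k : ℝ) (u : ℝ³ → ℝ³) (z : ℝ³) : ℝ≥0∞ :=
  ENNReal.ofReal ((whitneyRadius x₀ a b k z)⁻¹ ^ 2) *
    ∫⁻ x in ball z (10 * whitneyRadius x₀ a b k z), ‖fderiv ℝ (curl u) x‖ₑ ^ 2

/-- `Φ` is measurable. [folklore] -/
theorem measurable_dissOverlap (x₀ : ℝ³) (a b k : ℝ) {u : ℝ³ → ℝ³} (hu : ContDiff ℝ 2 u) :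
    Measurable (dissOverlap x₀ a b k u) := by
  have hω1 : ContDiff ℝ 1 (curl u) := contDiff_curl (n := 1) hu
  unfold dissOverlap
  refine Measurable.mul ?_ ?_
  · exact (((continuous_whitneyRadius x₀ a b k).measurable.inv).pow_const 2).ennreal_ofReal
  · exact measurable_setLIntegral_ball_var ((hω1.continuous_fderiv one_ne_zero).enorm.measurable.pow_const 2)
      (continuous_const.mul (continuous_whitneyRadius x₀ a b k))

/-- **The increment at a small iterate, pointwise**: for `y` on the inner layer with
`λᵐ t < k⁻¹/2`, `ρ(y) J(T^m y)³ ≤ 12996 C_W λ⁻ᵐ Φ(T^m y)`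
(`J³ ≤ 114² w D`, (10.23) at `T^m y`, `ρ(y) = λ⁻ᵐρ(T^m y)`). [cite: Tao2011, §10, proof of Thm. 10.1 (p. 33, "|w_j − w_{p(j)}|³ ≲ c^{0.05}δ⁻¹W^{1/2}r_j⁻³∫_{10B_j}|∇ω|²")] -/
theorem inner_incr_pointwise (ha : 0 < a) (hk : 0 < k) (hab : a + 2 * k⁻¹ < b) {u : ℝ³ → ℝ³}
    (hu : ContDiff ℝ 2 u) {y : ℝ³} (hy : a < ‖y - x₀‖) (m : ℕ)
    (hm : chainFactor ^ m * (‖y - x₀‖ - a) < k⁻¹ / 2) :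
    ENNReal.ofReal (whitneyRadius x₀ a b k y) *
        chainIncr x₀ a b k (curl u) (radialStep x₀ a (chainFactor ^ m) y) ^ 3 ≤
      12996 * ENNReal.ofReal (bongConst k (localisedEnstrophy (fun x => annularRamp k a b ‖x - x₀‖) u)) *
        ENNReal.ofReal (chainFactor ^ m)⁻¹ * dissOverlap x₀ a b k u (radialStep x₀ a (chainFactor ^ m) y) := by
  have hℓ0 : 0 < k⁻¹ := inv_pos.2 hk
  obtain ⟨hdz, hρz, hρy⟩ := inner_iterate (k := k) ha hk hab hy m (hm.trans (by linarith))
  set z := radialStep x₀ a (chainFactor ^ m) y with hz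
  set ρ := whitneyRadius x₀ a b k with hρ
  set W := localisedEnstrophy (fun x => annularRamp k a b ‖x - x₀‖) u with hW
  have hρz0 : 0 < ρ z := whitneyRadius_pos hk hdz
  have hω : Continuous (curl u) := continuous_curl (hu.of_le (by norm_num))
  have hb : rmsE (curl u) z (ρ z) ≤ ENNReal.ofReal (bongConst k W * (ρ z)⁻¹ ^ 2) :=
    rmsE_whitney_le (x₀ := x₀) (a := a) (b := b) hk hω hdz
  have hJ := min_pow_three_le (rmsE (curl u) z (ρ z)) (dissE (curl u) z (ρ z))
  rw [← chainIncr_def] at hJ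
  have hbong0 : 0 ≤ bongConst k W := Real.sqrt_nonneg _
  calc ENNReal.ofReal (ρ y) * chainIncr x₀ a b k (curl u) z ^ 3
      ≤ ENNReal.ofReal (ρ y) * (12996 * rmsE (curl u) z (ρ z) * dissE (curl u) z (ρ z)) :=
        mul_le_mul' le_rfl hJ
    _ ≤ ENNReal.ofReal ((chainFactor ^ m)⁻¹ * ρ z) *
          (12996 * ENNReal.ofReal (bongConst k W * (ρ z)⁻¹ ^ 2) * dissE (curl u) z (ρ z)) := by
        rw [hρy]; gcongr
    _ = 12996 * ENNReal.ofReal (bongConst k W) * ENNReal.ofReal (chainFactor ^ m)⁻¹ * dissOverlap x₀ a b k u z := by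
        have hcf0 : 0 ≤ (chainFactor ^ m)⁻¹ := inv_nonneg.2 (pow_pos chainFactor_pos m).le
        have e1 : ENNReal.ofReal ((chainFactor ^ m)⁻¹ * ρ z) =
            ENNReal.ofReal (chainFactor ^ m)⁻¹ * ENNReal.ofReal (ρ z) := ENNReal.ofReal_mul hcf0
        have e2 : ENNReal.ofReal (bongConst k W * (ρ z)⁻¹ ^ 2) =
            ENNReal.ofReal (bongConst k W) * ENNReal.ofReal ((ρ z)⁻¹ ^ 2) := ENNReal.ofReal_mul hbong0
        have e3 : ENNReal.ofReal (ρ z) * ENNReal.ofReal (ρ z)⁻¹ = 1 := by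
          rw [← ENNReal.ofReal_mul hρz0.le, mul_inv_cancel₀ hρz0.ne', ENNReal.ofReal_one]
        rw [e1, e2, dissE_def, dissOverlap, ← hρ]
        calc ENNReal.ofReal (chainFactor ^ m)⁻¹ * ENNReal.ofReal (ρ z) *
              (12996 * (ENNReal.ofReal (bongConst k W) * ENNReal.ofReal ((ρ z)⁻¹ ^ 2)) *
                (ENNReal.ofReal (ρ z)⁻¹ * ∫⁻ x in ball z (10 * ρ z), ‖fderiv ℝ (curl u) x‖ₑ ^ 2))
            = (ENNReal.ofReal (ρ z) * ENNReal.ofReal (ρ z)⁻¹) *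
                (12996 * ENNReal.ofReal (bongConst k W) * ENNReal.ofReal (chainFactor ^ m)⁻¹ *
                  (ENNReal.ofReal ((ρ z)⁻¹ ^ 2) * ∫⁻ x in ball z (10 * ρ z), ‖fderiv ℝ (curl u) x‖ₑ ^ 2)) := by
              ring
          _ = _ := by rw [e3, one_mul]

/-- **Term B at level `m`, integrated**: with `S_m = {a < |y-x₀| < a + λ⁻ᵐk⁻¹/2}` (the points
whose `m`-th iterate is still small),
`∫_{S_m} ρ(y) J(T^m y)³ dy ≤ 12996 C_W λ^{-2m} ∫ Φ` (the volume comparison along rays,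
`TaoY6RadialChange.lintegral_shell_comp_radialStep_le` with `K = 1`). [cite: Tao2011, §10, proof of Thm. 10.1 (p. 33, "Σ_{k≥0}(1+k)^{10}Σ_{i:pᵏ(i)=j} rᵢ⁴ ≲ rⱼ⁴")] -/
theorem inner_termB_le (ha : 0 < a) (hk : 0 < k) (hab : a + 2 * k⁻¹ < b) {u : ℝ³ → ℝ³}
    (hu : ContDiff ℝ 2 u) (m : ℕ) :
    ∫⁻ y in openShell x₀ a (a + (chainFactor ^ m)⁻¹ * (k⁻¹ / 2)),
        ENNReal.ofReal (whitneyRadius x₀ a b k y) *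
          chainIncr x₀ a b k (curl u) (radialStep x₀ a (chainFactor ^ m) y) ^ 3 ≤
      12996 * ENNReal.ofReal (bongConst k (localisedEnstrophy (fun x => annularRamp k a b ‖x - x₀‖) u)) *
        ENNReal.ofReal ((chainFactor ^ m)⁻¹ ^ 2) * ∫⁻ z, dissOverlap x₀ a b k u z := by
  set μm := chainFactor ^ m with hμm
  have hpow : 0 < μm := pow_pos chainFactor_pos m
  have hpow1 : 1 ≤ μm := one_le_pow₀ one_le_chainFactor
  set S : Set ℝ³ := openShell x₀ a (a + μm⁻¹ * (k⁻¹ / 2)) with hS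
  have hSm : MeasurableSet S := measurableSet_openShell x₀ _ _
  set C : ℝ≥0∞ := 12996 * ENNReal.ofReal (bongConst k (localisedEnstrophy (fun x => annularRamp k a b ‖x - x₀‖) u)) *
    ENNReal.ofReal μm⁻¹ with hC
  -- pointwise bound on `S`
  have hpt : ∀ y ∈ S, ENNReal.ofReal (whitneyRadius x₀ a b k y) *
      chainIncr x₀ a b k (curl u) (radialStep x₀ a μm y) ^ 3 ≤ C * dissOverlap x₀ a b k u (radialStep x₀ a μm y) := by
    intro y hy
    rw [hS, mem_openShell] at hy
    have hy1 : a < ‖y - x₀‖ := hy.1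
    have hm : μm * (‖y - x₀‖ - a) < k⁻¹ / 2 := by
      have h := hy.2
      have : ‖y - x₀‖ - a < μm⁻¹ * (k⁻¹ / 2) := by linarith
      calc μm * (‖y - x₀‖ - a) < μm * (μm⁻¹ * (k⁻¹ / 2)) := mul_lt_mul_of_pos_left this hpow
        _ = k⁻¹ / 2 := by field_simp
    exact inner_incr_pointwise ha hk hab hu hy1 m hm
  -- change of variables
  have hcv := lintegral_shell_comp_radialStep_le (x₀ := x₀) (p := a) (μ := μm)
    (measurable_dissOverlap x₀ a b k hu) hpow1 (r₁ := a) (r₂ := a + μm⁻¹ * (k⁻¹ / 2)) (K := 1) ha.le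
    zero_le_one (fun r hr => by
      rw [one_mul]
      have h1 : r ≤ a + μm * (r - a) := by nlinarith [hr.1]
      exact pow_le_pow_left₀ (by linarith [hr.1]) h1 2)
    (fun r hr => by nlinarith [hr.1])
  calc ∫⁻ y in S, ENNReal.ofReal (whitneyRadius x₀ a b k y) * chainIncr x₀ a b k (curl u) (radialStep x₀ a μm y) ^ 3
      ≤ ∫⁻ y in S, C * dissOverlap x₀ a b k u (radialStep x₀ a μm y) := setLIntegral_mono' hSm hpt
    _ = C * ∫⁻ y in S, dissOverlap x₀ a b k u (radialStep x₀ a μm y) := by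
        rw [lintegral_const_mul' _ _ (by rw [hC]; exact ENNReal.mul_ne_top (ENNReal.mul_ne_top (by norm_num) ENNReal.ofReal_ne_top) ENNReal.ofReal_ne_top)]
    _ ≤ C * (ENNReal.ofReal 1 * ENNReal.ofReal μm⁻¹ *
          ∫⁻ z in openShell x₀ (a + μm * (a - a)) (a + μm * (a + μm⁻¹ * (k⁻¹ / 2) - a)), dissOverlap x₀ a b k u z) :=
        mul_le_mul' le_rfl hcv
    _ ≤ C * (ENNReal.ofReal 1 * ENNReal.ofReal μm⁻¹ * ∫⁻ z, dissOverlap x₀ a b k u z) := by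
        gcongr
        exact Measure.restrict_le_self
    _ = 12996 * ENNReal.ofReal (bongConst k (localisedEnstrophy (fun x => annularRamp k a b ‖x - x₀‖) u)) *
          ENNReal.ofReal (μm⁻¹ ^ 2) * ∫⁻ z, dissOverlap x₀ a b k u z := by
        rw [hC, ENNReal.ofReal_one, one_mul, pow_two, ENNReal.ofReal_mul (by positivity)]
        ring

end InnerB

/-! ### The inner layer, term A: the last point of the chain -/

section InnerA

variable {x₀ : ℝ³} {a b k : ℝ}

/-- The integrand `Ψ(z) = ρ(z) w(z)³` of the chain bound. [folklore] -/
def chainDensity (x₀ : ℝ³) (a b k : ℝ) (u : ℝ³ → ℝ³) (z : ℝ³) : ℝ≥0∞ :=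
  ENNReal.ofReal (whitneyRadius x₀ a b k z) * rmsE (curl u) z (whitneyRadius x₀ a b k z) ^ 3

/-- `Ψ` is measurable. [folklore] -/
theorem measurable_chainDensity (x₀ : ℝ³) (a b k : ℝ) {u : ℝ³ → ℝ³} (hu : ContDiff ℝ 2 u) :
    Measurable (chainDensity x₀ a b k u) := by
  have hω : Continuous (curl u) := continuous_curl (hu.of_le (by norm_num))
  unfold chainDensity
  exact (continuous_whitneyRadius x₀ a b k).measurable.ennreal_ofReal.mul
    ((measurable_rmsE_var hω (continuous_whitneyRadius x₀ a b k)).pow_const 3)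

/-- **Term A at level `n`, integrated**: on the shell `{λ⁻ⁿk⁻¹/4 < |y-x₀| - a < λ⁻ⁿλk⁻¹/2}` (the
points whose chain has length `n`), `∫ ρ(y) w(Tⁿ y)³ dy ≤ λ^{-2n} ∫_{ρ ≥ (400k)⁻¹} ρ w³`
(`ρ(y) = λ⁻ⁿρ(Tⁿy)`, the volume comparison, and `Tⁿ` maps the shell into the large region).
[cite: Tao2011, §10, proof of Thm. 10.1 (p. 33, "Σ_{i:a(i)=j} rᵢ⁴ ≲ rⱼ⁴")] -/
theorem inner_termA_le (ha : 0 < a) (hk : 0 < k) (hab : a + 2 * k⁻¹ < b) {u : ℝ³ → ℝ³}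
    (hu : ContDiff ℝ 2 u) (n : ℕ) :
    ∫⁻ y in openShell x₀ (a + (chainFactor ^ n)⁻¹ * (k⁻¹ / 4)) (a + (chainFactor ^ n)⁻¹ * (chainFactor * k⁻¹ / 2)),
        ENNReal.ofReal (whitneyRadius x₀ a b k y) *
          rmsE (curl u) (radialStep x₀ a (chainFactor ^ n) y)
            (whitneyRadius x₀ a b k (radialStep x₀ a (chainFactor ^ n) y)) ^ 3 ≤
      ENNReal.ofReal ((chainFactor ^ n)⁻¹ ^ 2) *
        ∫⁻ z in {z | (400 * k)⁻¹ ≤ whitneyRadius x₀ a b k z}, chainDensity x₀ a b k u z := by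
  have hℓ : 0 < k⁻¹ := inv_pos.2 hk
  set μn := chainFactor ^ n with hμn
  have hpow : 0 < μn := pow_pos chainFactor_pos n
  have hpow1 : 1 ≤ μn := one_le_pow₀ one_le_chainFactor
  have hlam : chainFactor = 103 / 100 := chainFactor_eq
  set S : Set ℝ³ := openShell x₀ (a + μn⁻¹ * (k⁻¹ / 4)) (a + μn⁻¹ * (chainFactor * k⁻¹ / 2)) with hS
  have hSm : MeasurableSet S := measurableSet_openShell x₀ _ _
  -- pointwise: `ρ(y) w(Tⁿy)³ = λ⁻ⁿ Ψ(Tⁿ y)`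
  have hpt : ∀ y ∈ S, ENNReal.ofReal (whitneyRadius x₀ a b k y) *
      rmsE (curl u) (radialStep x₀ a μn y) (whitneyRadius x₀ a b k (radialStep x₀ a μn y)) ^ 3 ≤
      ENNReal.ofReal μn⁻¹ * chainDensity x₀ a b k u (radialStep x₀ a μn y) := by
    intro y hy
    rw [hS, mem_openShell] at hy
    have hy1 : a < ‖y - x₀‖ := by
      have : 0 < μn⁻¹ * (k⁻¹ / 4) := by positivity
      linarith [hy.1]
    have hm : μn * (‖y - x₀‖ - a) < k⁻¹ := by
      have : ‖y - x₀‖ - a < μn⁻¹ * (chainFactor * k⁻¹ / 2) := by linarith [hy.2]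
      calc μn * (‖y - x₀‖ - a) < μn * (μn⁻¹ * (chainFactor * k⁻¹ / 2)) := mul_lt_mul_of_pos_left this hpow
        _ = chainFactor * k⁻¹ / 2 := by field_simp
        _ < k⁻¹ := by rw [hlam]; linarith
    obtain ⟨-, -, hρy⟩ := inner_iterate (k := k) ha hk hab hy1 n hm
    rw [← hμn] at hρy
    rw [hρy, ENNReal.ofReal_mul (inv_nonneg.2 hpow.le), mul_assoc, chainDensity]
  -- change of variables
  have hcv := lintegral_shell_comp_radialStep_le (x₀ := x₀) (p := a) (μ := μn)
    (measurable_chainDensity x₀ a b k hu) hpow1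
    (r₁ := a + μn⁻¹ * (k⁻¹ / 4)) (r₂ := a + μn⁻¹ * (chainFactor * k⁻¹ / 2)) (K := 1)
    (by positivity) zero_le_one
    (fun r hr => by
      rw [one_mul]
      have h0 : 0 < μn⁻¹ * (k⁻¹ / 4) := by positivity
      have hr1 : a < r := by linarith [hr.1]
      have h1 : r ≤ a + μn * (r - a) := by nlinarith
      exact pow_le_pow_left₀ (by linarith) h1 2)
    (fun r hr => by
      have h0 : 0 < μn⁻¹ * (k⁻¹ / 4) := by positivity
      nlinarith [hr.1])
  -- the image shell lies in the large region
  have himg : openShell x₀ (a + μn * (a + μn⁻¹ * (k⁻¹ / 4) - a)) (a + μn * (a + μn⁻¹ * (chainFactor * k⁻¹ / 2) - a)) ⊆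
      {z | (400 * k)⁻¹ ≤ whitneyRadius x₀ a b k z} := by
    intro z hz
    rw [mem_openShell] at hz
    have e1 : μn * (a + μn⁻¹ * (k⁻¹ / 4) - a) = k⁻¹ / 4 := by
      rw [add_sub_cancel_left, ← mul_assoc, mul_inv_cancel₀ hpow.ne', one_mul]
    have e2 : μn * (a + μn⁻¹ * (chainFactor * k⁻¹ / 2) - a) = chainFactor * k⁻¹ / 2 := by
      rw [add_sub_cancel_left, ← mul_assoc, mul_inv_cancel₀ hpow.ne', one_mul]
    rw [e1, e2] at hz
    have ht0 : 0 ≤ ‖z - x₀‖ - a := by linarith [hz.1]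
    have ht1 : ‖z - x₀‖ - a ≤ (b - a) / 2 := by rw [hlam] at hz; linarith [hz.2]
    have ht2 : ‖z - x₀‖ - a ≤ k⁻¹ := by rw [hlam] at hz; linarith [hz.2]
    show (400 * k)⁻¹ ≤ whitneyRadius x₀ a b k z
    rw [whitneyRadius_eq_inner ht0 ht1 ht2]
    rw [show (400 * k)⁻¹ = k⁻¹ / 4 / 100 by field_simp; ring]
    exact div_le_div_of_nonneg_right (by linarith [hz.1]) (by norm_num)
  calc ∫⁻ y in S, ENNReal.ofReal (whitneyRadius x₀ a b k y) *
          rmsE (curl u) (radialStep x₀ a μn y) (whitneyRadius x₀ a b k (radialStep x₀ a μn y)) ^ 3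
      ≤ ∫⁻ y in S, ENNReal.ofReal μn⁻¹ * chainDensity x₀ a b k u (radialStep x₀ a μn y) := setLIntegral_mono' hSm hpt
    _ = ENNReal.ofReal μn⁻¹ * ∫⁻ y in S, chainDensity x₀ a b k u (radialStep x₀ a μn y) :=
        lintegral_const_mul' _ _ ENNReal.ofReal_ne_top
    _ ≤ ENNReal.ofReal μn⁻¹ * (ENNReal.ofReal 1 * ENNReal.ofReal μn⁻¹ *
          ∫⁻ z in openShell x₀ (a + μn * (a + μn⁻¹ * (k⁻¹ / 4) - a))
            (a + μn * (a + μn⁻¹ * (chainFactor * k⁻¹ / 2) - a)), chainDensity x₀ a b k u z) :=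
        mul_le_mul' le_rfl hcv
    _ ≤ ENNReal.ofReal μn⁻¹ * (ENNReal.ofReal 1 * ENNReal.ofReal μn⁻¹ *
          ∫⁻ z in {z | (400 * k)⁻¹ ≤ whitneyRadius x₀ a b k z}, chainDensity x₀ a b k u z) :=
        mul_le_mul' le_rfl (mul_le_mul' le_rfl (lintegral_mono_set himg))
    _ = ENNReal.ofReal (μn⁻¹ ^ 2) * ∫⁻ z in {z | (400 * k)⁻¹ ≤ whitneyRadius x₀ a b k z}, chainDensity x₀ a b k u z := by
        rw [ENNReal.ofReal_one, one_mul, ← mul_assoc, ← ENNReal.ofReal_mul (inv_nonneg.2 hpow.le), ← pow_two]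

end InnerA

/-! ### The inner layer: from the chain to the two terms -/

section InnerSmall

variable {x₀ : ℝ³} {a b k : ℝ}

/-- The `n`-th term of type A: `1_{Sh_{n+1}}(y) ρ(y) w(Tⁿ⁺¹ y)³`. [folklore] -/
def innerTermA (x₀ : ℝ³) (a b k : ℝ) (u : ℝ³ → ℝ³) (n : ℕ) (y : ℝ³) : ℝ≥0∞ :=
  (openShell x₀ (a + (chainFactor ^ (n + 1))⁻¹ * (k⁻¹ / 4))
      (a + (chainFactor ^ (n + 1))⁻¹ * (chainFactor * k⁻¹ / 2))).indicator
    (fun y => ENNReal.ofReal (whitneyRadius x₀ a b k y) *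
      rmsE (curl u) (radialStep x₀ a (chainFactor ^ (n + 1)) y)
        (whitneyRadius x₀ a b k (radialStep x₀ a (chainFactor ^ (n + 1)) y)) ^ 3) y

/-- The `m`-th term of type B: `s^{2m} 1_{S_m}(y) ρ(y) J(Tᵐ y)³`. [folklore] -/
def innerTermB (x₀ : ℝ³) (a b k : ℝ) (u : ℝ³ → ℝ³) (m : ℕ) (y : ℝ³) : ℝ≥0∞ :=
  ENNReal.ofReal (chainWeight ^ (2 * m)) *
    (openShell x₀ a (a + (chainFactor ^ m)⁻¹ * (k⁻¹ / 2))).indicator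
      (fun y => ENNReal.ofReal (whitneyRadius x₀ a b k y) *
        chainIncr x₀ a b k (curl u) (radialStep x₀ a (chainFactor ^ m) y) ^ 3) y

/-- Measurability of the terms of type A. [folklore] -/
theorem measurable_innerTermA (x₀ : ℝ³) (a b k : ℝ) {u : ℝ³ → ℝ³} (hu : ContDiff ℝ 2 u) (n : ℕ) :
    Measurable (innerTermA x₀ a b k u n) := by
  have hω : Continuous (curl u) := continuous_curl (hu.of_le (by norm_num))
  unfold innerTermA
  refine Measurable.indicator ?_ (measurableSet_openShell x₀ _ _)
  exact (continuous_whitneyRadius x₀ a b k).measurable.ennreal_ofReal.mul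
    (((measurable_rmsE_var hω (continuous_whitneyRadius x₀ a b k)).comp
      (measurable_radialStep x₀ a _)).pow_const 3)

/-- Measurability of the increments in the centre. [folklore] -/
theorem measurable_chainIncr (x₀ : ℝ³) (a b k : ℝ) {u : ℝ³ → ℝ³} (hu : ContDiff ℝ 2 u) :
    Measurable (chainIncr x₀ a b k (curl u)) := by
  have hω : Continuous (curl u) := continuous_curl (hu.of_le (by norm_num))
  have hω1 : ContDiff ℝ 1 (curl u) := contDiff_curl (n := 1) hu
  unfold chainIncr
  exact (measurable_rmsE_var hω (continuous_whitneyRadius x₀ a b k)).min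
    (measurable_const.mul ((measurable_dissE_var hω1 (continuous_whitneyRadius x₀ a b k)).pow_const _))

/-- Measurability of the terms of type B. [folklore] -/
theorem measurable_innerTermB (x₀ : ℝ³) (a b k : ℝ) {u : ℝ³ → ℝ³} (hu : ContDiff ℝ 2 u) (m : ℕ) :
    Measurable (innerTermB x₀ a b k u m) := by
  unfold innerTermB
  refine measurable_const.mul (Measurable.indicator ?_ (measurableSet_openShell x₀ _ _))
  exact (continuous_whitneyRadius x₀ a b k).measurable.ennreal_ofReal.mul
    (((measurable_chainIncr x₀ a b k hu).comp (measurable_radialStep x₀ a _)).pow_const 3)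

/-- **The chain at a point of the inner layer** (telescoping to the first large iterate, cubes with
geometric Hölder weights): for `0 < |y - x₀| - a < k⁻¹/2`,
`ρ(y) w(y)³ ≤ 4 Σₙ A_n(y) + 40804 Σₘ B_m(y)`. [cite: Tao2011, §10, proof of Thm. 10.1 (p. 33, "w_i³ ≲ w_{a(i)}³ + Σ_{k≥0}(1+k)^{10}|w_{pᵏ(i)} − w_{pᵏ⁺¹(i)}|³")] -/
theorem inner_pointwise (ha : 0 < a) (hk : 0 < k) (hab : a + 2 * k⁻¹ < b) {u : ℝ³ → ℝ³}
    (hu : ContDiff ℝ 2 u) {y : ℝ³} (hy1 : a < ‖y - x₀‖) (hy2 : ‖y - x₀‖ - a < k⁻¹ / 2) :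
    chainDensity x₀ a b k u y ≤
      4 * (∑' n, innerTermA x₀ a b k u n y) + 40804 * ∑' m, innerTermB x₀ a b k u m y := by
  classical
  have hℓ : 0 < k⁻¹ := inv_pos.2 hk
  have ht0 : 0 < ‖y - x₀‖ - a := by linarith
  have hω1 : ContDiff ℝ 1 (curl u) := contDiff_curl (n := 1) hu
  set t := ‖y - x₀‖ - a with ht
  -- the chain length
  have hex : ∃ m : ℕ, k⁻¹ / 2 ≤ chainFactor ^ m * t := by
    obtain ⟨m, hm⟩ := pow_unbounded_of_one_lt (k⁻¹ / 2 / t) one_lt_chainFactor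
    refine ⟨m, ?_⟩
    rw [div_lt_iff₀ ht0] at hm
    exact hm.le
  set M := Nat.find hex with hMdef
  have hM : k⁻¹ / 2 ≤ chainFactor ^ M * t := Nat.find_spec hex
  have hmin : ∀ m < M, chainFactor ^ m * t < k⁻¹ / 2 := fun m hm => lt_of_not_ge (Nat.find_min hex hm)
  have hM0 : M ≠ 0 := by
    intro h
    have := hM
    rw [h, pow_zero, one_mul] at this
    linarith
  obtain ⟨M', hM'0⟩ := Nat.exists_eq_succ_of_ne_zero hM0
  have hM' : M = M' + 1 := hM'0
  -- telescoping and cubes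
  have htele := rmsE_le_rmsE_iterate_add_sum (b := b) ha hk hab hω1 hy1 M hmin
  set A := rmsE (curl u) (radialStep x₀ a (chainFactor ^ M) y)
    (whitneyRadius x₀ a b k (radialStep x₀ a (chainFactor ^ M) y)) with hA
  set J : ℕ → ℝ≥0∞ := fun m => chainIncr x₀ a b k (curl u) (radialStep x₀ a (chainFactor ^ m) y) with hJ
  have hcube : rmsE (curl u) y (whitneyRadius x₀ a b k y) ^ 3 ≤
      4 * A ^ 3 + 40804 * ∑ m ∈ Finset.range M, ENNReal.ofReal (chainWeight ^ (2 * m)) * J m ^ 3 := by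
    calc rmsE (curl u) y (whitneyRadius x₀ a b k y) ^ 3
        ≤ (A + ∑ m ∈ Finset.range M, J m) ^ 3 := pow_le_pow_left' htele 3
      _ ≤ 4 * A ^ 3 + 4 * (∑ m ∈ Finset.range M, J m) ^ 3 := y6_add_pow_three_le _ _
      _ ≤ 4 * A ^ 3 + 4 * (10201 * ∑ m ∈ Finset.range M, ENNReal.ofReal (chainWeight ^ (2 * m)) * J m ^ 3) := by
          gcongr
          exact cube_sum_le_weighted J M
      _ = _ := by ring
  -- membership of `y` in the shells
  have hpowM : 0 < chainFactor ^ M := pow_pos chainFactor_pos M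
  have hyA : y ∈ openShell x₀ (a + (chainFactor ^ (M' + 1))⁻¹ * (k⁻¹ / 4))
      (a + (chainFactor ^ (M' + 1))⁻¹ * (chainFactor * k⁻¹ / 2)) := by
    rw [← hM', mem_openShell]
    constructor
    · -- `t ≥ λ^{-M} ℓ/2 > λ^{-M} ℓ/4`
      have h1 : (chainFactor ^ M)⁻¹ * (k⁻¹ / 2) ≤ t := by
        rw [inv_mul_le_iff₀ hpowM]; exact hM
      have h2 : (chainFactor ^ M)⁻¹ * (k⁻¹ / 4) < (chainFactor ^ M)⁻¹ * (k⁻¹ / 2) :=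
        mul_lt_mul_of_pos_left (by linarith) (inv_pos.2 hpowM)
      rw [ht] at h1; linarith
    · -- `λ^{M'} t < ℓ/2`
      have h1 : chainFactor ^ M' * t < k⁻¹ / 2 := hmin M' (by rw [hM']; exact Nat.lt_succ_self M')
      have h2 : t < (chainFactor ^ M)⁻¹ * (chainFactor * k⁻¹ / 2) := by
        rw [lt_inv_mul_iff₀ hpowM, hM', pow_succ]
        nlinarith [chainFactor_pos]
      rw [ht] at h2; linarith
  have hyB : ∀ m < M, y ∈ openShell x₀ a (a + (chainFactor ^ m)⁻¹ * (k⁻¹ / 2)) := by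
    intro m hm
    rw [mem_openShell]
    refine ⟨hy1, ?_⟩
    have h1 := hmin m hm
    have h2 : t < (chainFactor ^ m)⁻¹ * (k⁻¹ / 2) := by
      rw [lt_inv_mul_iff₀ (pow_pos chainFactor_pos m)]; exact h1
    rw [ht] at h2; linarith
  -- the A-term is one term of the A-series
  have hAterm : ENNReal.ofReal (whitneyRadius x₀ a b k y) * A ^ 3 ≤ ∑' n, innerTermA x₀ a b k u n y := by
    calc ENNReal.ofReal (whitneyRadius x₀ a b k y) * A ^ 3 = innerTermA x₀ a b k u M' y := by
          rw [innerTermA, indicator_of_mem hyA, hA, hM']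
      _ ≤ ∑' n, innerTermA x₀ a b k u n y := ENNReal.le_tsum M'
  -- the B-terms are terms of the B-series
  have hBterm : ∑ m ∈ Finset.range M, ENNReal.ofReal (chainWeight ^ (2 * m)) *
      (ENNReal.ofReal (whitneyRadius x₀ a b k y) * J m ^ 3) ≤ ∑' m, innerTermB x₀ a b k u m y := by
    calc ∑ m ∈ Finset.range M, ENNReal.ofReal (chainWeight ^ (2 * m)) *
          (ENNReal.ofReal (whitneyRadius x₀ a b k y) * J m ^ 3)
        = ∑ m ∈ Finset.range M, innerTermB x₀ a b k u m y := by
          refine Finset.sum_congr rfl fun m hm => ?_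
          rw [innerTermB, indicator_of_mem (hyB m (Finset.mem_range.1 hm))]
      _ ≤ ∑' m, innerTermB x₀ a b k u m y := ENNReal.sum_le_tsum _
  -- assemble
  calc chainDensity x₀ a b k u y
      = ENNReal.ofReal (whitneyRadius x₀ a b k y) * rmsE (curl u) y (whitneyRadius x₀ a b k y) ^ 3 := rfl
    _ ≤ ENNReal.ofReal (whitneyRadius x₀ a b k y) *
          (4 * A ^ 3 + 40804 * ∑ m ∈ Finset.range M, ENNReal.ofReal (chainWeight ^ (2 * m)) * J m ^ 3) :=
        mul_le_mul' le_rfl hcube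
    _ = 4 * (ENNReal.ofReal (whitneyRadius x₀ a b k y) * A ^ 3) +
          40804 * ∑ m ∈ Finset.range M, ENNReal.ofReal (chainWeight ^ (2 * m)) *
            (ENNReal.ofReal (whitneyRadius x₀ a b k y) * J m ^ 3) := by
        rw [mul_add, Finset.mul_sum, Finset.mul_sum, Finset.mul_sum]
        congr 1
        · ring
        · refine Finset.sum_congr rfl fun m _ => ?_; ring
    _ ≤ 4 * (∑' n, innerTermA x₀ a b k u n y) + 40804 * ∑' m, innerTermB x₀ a b k u m y := by
        gcongr

/-- **The inner layer, integrated**: `∫_{0<|y-x₀|-a<k⁻¹/2} ρ w³ ≤ 4 Σₙ ∫A_n + 40804 Σₘ ∫B_m`.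
[cite: Tao2011, §10, proof of Thm. 10.1 (p. 33)] -/
theorem inner_small_le (ha : 0 < a) (hk : 0 < k) (hab : a + 2 * k⁻¹ < b) {u : ℝ³ → ℝ³}
    (hu : ContDiff ℝ 2 u) :
    ∫⁻ y in openShell x₀ a (a + k⁻¹ / 2), chainDensity x₀ a b k u y ≤
      4 * (∑' n, ∫⁻ y, innerTermA x₀ a b k u n y) + 40804 * ∑' m, ∫⁻ y, innerTermB x₀ a b k u m y := by
  have hSm : MeasurableSet (openShell x₀ a (a + k⁻¹ / 2)) := measurableSet_openShell x₀ _ _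
  have hpt : ∀ y ∈ openShell x₀ a (a + k⁻¹ / 2), chainDensity x₀ a b k u y ≤
      4 * (∑' n, innerTermA x₀ a b k u n y) + 40804 * ∑' m, innerTermB x₀ a b k u m y := by
    intro y hy
    rw [mem_openShell] at hy
    exact inner_pointwise ha hk hab hu hy.1 (by linarith [hy.2])
  have hA : ∀ n, AEMeasurable (innerTermA x₀ a b k u n) volume := fun n =>
    (measurable_innerTermA x₀ a b k hu n).aemeasurable
  have hB : ∀ m, AEMeasurable (innerTermB x₀ a b k u m) volume := fun m =>
    (measurable_innerTermB x₀ a b k hu m).aemeasurable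
  have hmA : AEMeasurable (fun y => ∑' n, innerTermA x₀ a b k u n y) volume := AEMeasurable.tsum hA
  have hmB : AEMeasurable (fun y => ∑' m, innerTermB x₀ a b k u m y) volume := AEMeasurable.tsum hB
  calc ∫⁻ y in openShell x₀ a (a + k⁻¹ / 2), chainDensity x₀ a b k u y
      ≤ ∫⁻ y in openShell x₀ a (a + k⁻¹ / 2),
          (4 * (∑' n, innerTermA x₀ a b k u n y) + 40804 * ∑' m, innerTermB x₀ a b k u m y) :=
        setLIntegral_mono' hSm hpt
    _ ≤ ∫⁻ y, (4 * (∑' n, innerTermA x₀ a b k u n y) + 40804 * ∑' m, innerTermB x₀ a b k u m y) :=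
        setLIntegral_le_lintegral _ _
    _ = (4 * ∫⁻ y, ∑' n, innerTermA x₀ a b k u n y) + 40804 * ∫⁻ y, ∑' m, innerTermB x₀ a b k u m y := by
        rw [lintegral_add_left' (hmA.const_mul 4), lintegral_const_mul'' _ hmA, lintegral_const_mul'' _ hmB]
    _ = 4 * (∑' n, ∫⁻ y, innerTermA x₀ a b k u n y) + 40804 * ∑' m, ∫⁻ y, innerTermB x₀ a b k u m y := by
        rw [lintegral_tsum hA, lintegral_tsum hB]

end InnerSmall

/-! ### The inner layer, total -/

section InnerTotal

variable {x₀ : ℝ³} {a b k : ℝ}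

/-- `Σₙ (λⁿ⁺¹)⁻² ≤ 18` for `λ = 103/100`. [folklore] -/
theorem tsum_chainFactor_termA_le :
    ∑' n : ℕ, ENNReal.ofReal ((chainFactor ^ (n + 1))⁻¹ ^ 2) ≤ 18 := by
  set q : ℝ := (chainFactor⁻¹) ^ 2 with hq
  have hq0 : 0 ≤ q := by positivity
  have hq1 : q < 1 := by rw [hq, chainFactor_eq]; norm_num
  have hterm : ∀ n : ℕ, (chainFactor ^ (n + 1))⁻¹ ^ 2 ≤ q ^ n := fun n => by
    have e : (chainFactor ^ (n + 1))⁻¹ ^ 2 = q ^ (n + 1) := by rw [hq, ← inv_pow, ← pow_mul, ← pow_mul, mul_comm]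
    rw [e, pow_succ]
    exact mul_le_of_le_one_right (pow_nonneg hq0 n) hq1.le
  have hs : Summable fun n : ℕ => q ^ n := summable_geometric_of_lt_one hq0 hq1
  calc ∑' n : ℕ, ENNReal.ofReal ((chainFactor ^ (n + 1))⁻¹ ^ 2) ≤ ∑' n : ℕ, ENNReal.ofReal (q ^ n) :=
        ENNReal.tsum_le_tsum fun n => ENNReal.ofReal_le_ofReal (hterm n)
    _ = ENNReal.ofReal (∑' n : ℕ, q ^ n) := (ENNReal.ofReal_tsum_of_nonneg (fun n => pow_nonneg hq0 n) hs).symm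
    _ = ENNReal.ofReal (1 - q)⁻¹ := by rw [tsum_geometric_of_lt_one hq0 hq1]
    _ ≤ 18 := by
        rw [show (18 : ℝ≥0∞) = ENNReal.ofReal 18 by norm_num]
        refine ENNReal.ofReal_le_ofReal ?_
        rw [hq, chainFactor_eq]; norm_num

/-- `Σₘ s^{2m} (λᵐ)⁻² ≤ 27` for `s = 101/100`, `λ = 103/100`. [folklore] -/
theorem tsum_chainWeight_termB_le :
    ∑' m : ℕ, ENNReal.ofReal (chainWeight ^ (2 * m)) * ENNReal.ofReal ((chainFactor ^ m)⁻¹ ^ 2) ≤ 27 := by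
  set q : ℝ := (chainWeight * chainFactor⁻¹) ^ 2 with hq
  have hq0 : 0 ≤ q := by positivity
  have hq1 : q < 1 := by rw [hq, chainFactor_eq, chainWeight_eq]; norm_num
  have hw0 : 0 ≤ chainWeight := by rw [chainWeight_eq]; norm_num
  have hterm : ∀ m : ℕ, ENNReal.ofReal (chainWeight ^ (2 * m)) * ENNReal.ofReal ((chainFactor ^ m)⁻¹ ^ 2) =
      ENNReal.ofReal (q ^ m) := fun m => by
    rw [← ENNReal.ofReal_mul (by positivity), hq]
    congr 1
    rw [← pow_mul, mul_pow, ← inv_pow, ← pow_mul, mul_comm m 2]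
  have hs : Summable fun m : ℕ => q ^ m := summable_geometric_of_lt_one hq0 hq1
  calc ∑' m : ℕ, ENNReal.ofReal (chainWeight ^ (2 * m)) * ENNReal.ofReal ((chainFactor ^ m)⁻¹ ^ 2)
      = ∑' m : ℕ, ENNReal.ofReal (q ^ m) := tsum_congr hterm
    _ = ENNReal.ofReal (∑' m : ℕ, q ^ m) := (ENNReal.ofReal_tsum_of_nonneg (fun m => pow_nonneg hq0 m) hs).symm
    _ = ENNReal.ofReal (1 - q)⁻¹ := by rw [tsum_geometric_of_lt_one hq0 hq1]
    _ ≤ 27 := by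
        rw [show (27 : ℝ≥0∞) = ENNReal.ofReal 27 by norm_num]
        refine ENNReal.ofReal_le_ofReal ?_
        rw [hq, chainFactor_eq, chainWeight_eq]; norm_num

/-- **The inner layer, total**: `∫_{0<|y-x₀|-a<k⁻¹/2} ρ w³ ≤ 72 ∫_{ρ≥(400k)⁻¹} ρ w³ + 40804·12996·27 C_W ∫ Φ`.
[cite: Tao2011, §10, proof of Thm. 10.1 (p. 33)] -/
theorem inner_total_le (ha : 0 < a) (hk : 0 < k) (hab : a + 2 * k⁻¹ < b) {u : ℝ³ → ℝ³}
    (hu : ContDiff ℝ 2 u) :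
    ∫⁻ y in openShell x₀ a (a + k⁻¹ / 2), chainDensity x₀ a b k u y ≤
      72 * (∫⁻ z in {z | (400 * k)⁻¹ ≤ whitneyRadius x₀ a b k z}, chainDensity x₀ a b k u z) +
        40804 * 12996 * 27 *
          ENNReal.ofReal (bongConst k (localisedEnstrophy (fun x => annularRamp k a b ‖x - x₀‖) u)) *
            ∫⁻ z, dissOverlap x₀ a b k u z := by
  set IL := ∫⁻ z in {z | (400 * k)⁻¹ ≤ whitneyRadius x₀ a b k z}, chainDensity x₀ a b k u z with hIL
  set IΦ := ∫⁻ z, dissOverlap x₀ a b k u z with hIΦ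
  set CW := ENNReal.ofReal (bongConst k (localisedEnstrophy (fun x => annularRamp k a b ‖x - x₀‖) u)) with hCW
  -- the A-series
  have hA : ∀ n, ∫⁻ y, innerTermA x₀ a b k u n y ≤ ENNReal.ofReal ((chainFactor ^ (n + 1))⁻¹ ^ 2) * IL := by
    intro n
    have e : (fun y => innerTermA x₀ a b k u n y) =
        (openShell x₀ (a + (chainFactor ^ (n + 1))⁻¹ * (k⁻¹ / 4))
          (a + (chainFactor ^ (n + 1))⁻¹ * (chainFactor * k⁻¹ / 2))).indicator
        (fun y => ENNReal.ofReal (whitneyRadius x₀ a b k y) *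
          rmsE (curl u) (radialStep x₀ a (chainFactor ^ (n + 1)) y)
            (whitneyRadius x₀ a b k (radialStep x₀ a (chainFactor ^ (n + 1)) y)) ^ 3) := rfl
    rw [e, lintegral_indicator (measurableSet_openShell x₀ _ _)]
    exact inner_termA_le ha hk hab hu (n + 1)
  -- the B-series
  have hB : ∀ m, ∫⁻ y, innerTermB x₀ a b k u m y ≤
      ENNReal.ofReal (chainWeight ^ (2 * m)) * ENNReal.ofReal ((chainFactor ^ m)⁻¹ ^ 2) * (12996 * CW * IΦ) := by
    intro m
    have e : (fun y => innerTermB x₀ a b k u m y) = fun y => ENNReal.ofReal (chainWeight ^ (2 * m)) *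
        (openShell x₀ a (a + (chainFactor ^ m)⁻¹ * (k⁻¹ / 2))).indicator
          (fun y => ENNReal.ofReal (whitneyRadius x₀ a b k y) *
            chainIncr x₀ a b k (curl u) (radialStep x₀ a (chainFactor ^ m) y) ^ 3) y := rfl
    rw [e, lintegral_const_mul' _ _ ENNReal.ofReal_ne_top, lintegral_indicator (measurableSet_openShell x₀ _ _)]
    calc ENNReal.ofReal (chainWeight ^ (2 * m)) *
          ∫⁻ y in openShell x₀ a (a + (chainFactor ^ m)⁻¹ * (k⁻¹ / 2)),
            ENNReal.ofReal (whitneyRadius x₀ a b k y) * chainIncr x₀ a b k (curl u) (radialStep x₀ a (chainFactor ^ m) y) ^ 3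
        ≤ ENNReal.ofReal (chainWeight ^ (2 * m)) * (12996 * CW * ENNReal.ofReal ((chainFactor ^ m)⁻¹ ^ 2) * IΦ) :=
          mul_le_mul' le_rfl (inner_termB_le ha hk hab hu m)
      _ = _ := by ring
  calc ∫⁻ y in openShell x₀ a (a + k⁻¹ / 2), chainDensity x₀ a b k u y
      ≤ 4 * (∑' n, ∫⁻ y, innerTermA x₀ a b k u n y) + 40804 * ∑' m, ∫⁻ y, innerTermB x₀ a b k u m y :=
        inner_small_le ha hk hab hu
    _ ≤ 4 * (∑' n, ENNReal.ofReal ((chainFactor ^ (n + 1))⁻¹ ^ 2) * IL) +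
          40804 * ∑' m, ENNReal.ofReal (chainWeight ^ (2 * m)) * ENNReal.ofReal ((chainFactor ^ m)⁻¹ ^ 2) *
            (12996 * CW * IΦ) := by
        gcongr
        · exact hA _
        · exact hB _
    _ = 4 * ((∑' n, ENNReal.ofReal ((chainFactor ^ (n + 1))⁻¹ ^ 2)) * IL) +
          40804 * ((∑' m, ENNReal.ofReal (chainWeight ^ (2 * m)) * ENNReal.ofReal ((chainFactor ^ m)⁻¹ ^ 2)) *
            (12996 * CW * IΦ)) := by
        rw [ENNReal.tsum_mul_right, ENNReal.tsum_mul_right]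
    _ ≤ 4 * (18 * IL) + 40804 * (27 * (12996 * CW * IΦ)) := by
        gcongr
        · exact tsum_chainFactor_termA_le
        · exact tsum_chainWeight_termB_le
    _ = 72 * IL + 40804 * 12996 * 27 * CW * IΦ := by ring

end InnerTotal

/-! ### The outer layer: chain, iterates, terms B and A (mirror of the inner layer) -/

section OuterChain

variable {x₀ : ℝ³} {a b k : ℝ}

/-- **One step of the outer chain**: for `ω ∈ C¹`, `0 < a`, `a + 2k⁻¹ < b`, and a point `y` of
the outer layer with `0 < b - |y - x₀| < k⁻¹/2`:
`w(y) ≤ w(T y) + J(y)`, `T = radialStep x₀ b λ`. [cite: Tao2011, §10, proof of Thm. 10.1 (p. 33)] -/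
theorem rmsE_le_rmsE_outerStep_add (ha : 0 < a) (hk : 0 < k) (hab : a + 2 * k⁻¹ < b)
    {ω : ℝ³ → ℝ³} (hω : ContDiff ℝ 1 ω) {y : ℝ³} (hy : ‖y - x₀‖ < b)
    (hsmall : b - ‖y - x₀‖ < k⁻¹ / 2) :
    rmsE ω y (whitneyRadius x₀ a b k y) ≤
      rmsE ω (radialStep x₀ b chainFactor y) (whitneyRadius x₀ a b k (radialStep x₀ b chainFactor y)) +
        chainIncr x₀ a b k ω y := by
  have hℓ : 0 < k⁻¹ := inv_pos.2 hk
  have ht0 : 0 < b - ‖y - x₀‖ := by linarith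
  have hlam := one_lt_chainFactor
  have hy0 : y ≠ x₀ := by
    intro h; rw [h, sub_self, norm_zero] at hsmall; linarith
  have h1 : chainFactor * (b - ‖y - x₀‖) ≤ (b - a) / 2 := by
    rw [chainFactor_eq]; nlinarith
  have h2 : chainFactor * (b - ‖y - x₀‖) ≤ k⁻¹ := by
    rw [chainFactor_eq]; nlinarith
  have h3 : chainFactor * (b - ‖y - x₀‖) ≤ b := by
    rw [chainFactor_eq]; nlinarith
  obtain ⟨hρT, hdT⟩ := outer_parent (a := a) (k := k) hy0 hy h1 h2 h3
  have hd : 0 < annDepth x₀ a b y := by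
    rw [annDepth_eq_outer (by linarith)]; exact ht0
  have hρ : 0 < whitneyRadius x₀ a b k y := whitneyRadius_pos hk hd
  have hP := rmsE_le_rmsE_parent_add hω hρ hρT hdT
  rw [chainIncr_def]
  rcases le_total (rmsE ω y (whitneyRadius x₀ a b k y))
      (114 * dissE ω y (whitneyRadius x₀ a b k y) ^ (1 / 2 : ℝ)) with h | h
  · rw [min_eq_left h]; exact le_add_self
  · rw [min_eq_right h]; exact hP

/-- **The telescoping bound of the outer chain**: for `y` on the outer layer and `n` such that
all the points `T^m y`, `m < n`, are still small (`λᵐ(b - |y - x₀|) < k⁻¹/2`),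
`w(y) ≤ w(T^n y) + Σ_{m<n} J(T^m y)`, `T^m = radialStep x₀ b λᵐ`. [cite: Tao2011, §10, proof of Thm. 10.1 (p. 33)] -/
theorem rmsE_le_rmsE_outerIterate_add_sum (ha : 0 < a) (hk : 0 < k) (hab : a + 2 * k⁻¹ < b)
    {ω : ℝ³ → ℝ³} (hω : ContDiff ℝ 1 ω) {y : ℝ³} (hy : ‖y - x₀‖ < b)
    (hsmall : b - ‖y - x₀‖ < k⁻¹ / 2) (n : ℕ)
    (hn : ∀ m < n, chainFactor ^ m * (b - ‖y - x₀‖) < k⁻¹ / 2) :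
    rmsE ω y (whitneyRadius x₀ a b k y) ≤
      rmsE ω (radialStep x₀ b (chainFactor ^ n) y) (whitneyRadius x₀ a b k (radialStep x₀ b (chainFactor ^ n) y)) +
        ∑ m ∈ Finset.range n, chainIncr x₀ a b k ω (radialStep x₀ b (chainFactor ^ m) y) := by
  have hℓ : 0 < k⁻¹ := inv_pos.2 hk
  have hy0 : y ≠ x₀ := by
    intro h; rw [h, sub_self, norm_zero] at hsmall; linarith
  have ht0 : 0 < b - ‖y - x₀‖ := by linarith
  induction n with
  | zero => simp [radialStep_factor_one]
  | succ n ih =>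
    have hn' : ∀ m < n, chainFactor ^ m * (b - ‖y - x₀‖) < k⁻¹ / 2 := fun m hm => hn m (Nat.lt_succ_of_lt hm)
    have h0 := ih hn'
    set y' := radialStep x₀ b (chainFactor ^ n) y with hy'
    have hpow : 0 < chainFactor ^ n := pow_pos chainFactor_pos n
    have hnn : chainFactor ^ n * (b - ‖y - x₀‖) < k⁻¹ / 2 := hn n (Nat.lt_succ_self n)
    have hdep : b - ‖y' - x₀‖ = chainFactor ^ n * (b - ‖y - x₀‖) :=
      outer_depth_radialStep hy0 (by linarith)
    have hy'in : ‖y' - x₀‖ < b := by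
      have : 0 < chainFactor ^ n * (b - ‖y - x₀‖) := mul_pos hpow ht0
      linarith
    have hy'small : b - ‖y' - x₀‖ < k⁻¹ / 2 := by rw [hdep]; exact hnn
    have hstep := rmsE_le_rmsE_outerStep_add (a := a) ha hk hab hω hy'in hy'small
    have hcomp : radialStep x₀ b chainFactor y' = radialStep x₀ b (chainFactor ^ (n + 1)) y := by
      rw [hy', radialStep_radialStep hy0, pow_succ, mul_comm]
      have : chainFactor ^ n * (‖y - x₀‖ - b) = -(chainFactor ^ n * (b - ‖y - x₀‖)) := by ring
      rw [this]
      linarith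
    rw [hcomp] at hstep
    calc rmsE ω y (whitneyRadius x₀ a b k y)
        ≤ rmsE ω y' (whitneyRadius x₀ a b k y') +
            ∑ m ∈ Finset.range n, chainIncr x₀ a b k ω (radialStep x₀ b (chainFactor ^ m) y) := h0
      _ ≤ (rmsE ω (radialStep x₀ b (chainFactor ^ (n + 1)) y)
              (whitneyRadius x₀ a b k (radialStep x₀ b (chainFactor ^ (n + 1)) y)) + chainIncr x₀ a b k ω y') +
            ∑ m ∈ Finset.range n, chainIncr x₀ a b k ω (radialStep x₀ b (chainFactor ^ m) y) := by
          gcongr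
      _ = _ := by rw [Finset.sum_range_succ, hy']; ring

/-- **The iterate `T^m y` of a point of the outer layer, in the linear regime**: if
`0 < t = b - |y - x₀|` and `λᵐ t < k⁻¹`, then `z = radialStep x₀ b λᵐ y` lies in the open annulus
with `ρ(z) = λᵐ t/100` and `ρ(y) = λ⁻ᵐ ρ(z)`. [folklore] -/
theorem outer_iterate (ha : 0 < a) (hk : 0 < k) (hab : a + 2 * k⁻¹ < b) {y : ℝ³} (hy : ‖y - x₀‖ < b)
    (m : ℕ) (hm : chainFactor ^ m * (b - ‖y - x₀‖) < k⁻¹) :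
    0 < annDepth x₀ a b (radialStep x₀ b (chainFactor ^ m) y) ∧
      whitneyRadius x₀ a b k (radialStep x₀ b (chainFactor ^ m) y) = chainFactor ^ m * (b - ‖y - x₀‖) / 100 ∧
      whitneyRadius x₀ a b k y = (chainFactor ^ m)⁻¹ * whitneyRadius x₀ a b k (radialStep x₀ b (chainFactor ^ m) y) := by
  have hℓ : 0 < k⁻¹ := inv_pos.2 hk
  have ht0 : 0 < b - ‖y - x₀‖ := by linarith
  have hpow : 0 < chainFactor ^ m := pow_pos chainFactor_pos m
  have hpow1 : 1 ≤ chainFactor ^ m := one_le_pow₀ one_le_chainFactor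
  have htm : 0 < chainFactor ^ m * (b - ‖y - x₀‖) := mul_pos hpow ht0
  have ht1 : b - ‖y - x₀‖ < k⁻¹ := lt_of_le_of_lt (le_mul_of_one_le_left ht0.le hpow1) hm
  have hy0 : y ≠ x₀ := by
    intro h; rw [h, sub_self, norm_zero] at ht1; linarith
  have hdep : b - ‖radialStep x₀ b (chainFactor ^ m) y - x₀‖ = chainFactor ^ m * (b - ‖y - x₀‖) :=
    outer_depth_radialStep hy0 (by linarith)
  have hd : annDepth x₀ a b (radialStep x₀ b (chainFactor ^ m) y) = chainFactor ^ m * (b - ‖y - x₀‖) := by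
    rw [annDepth_eq_outer (by rw [hdep]; linarith), hdep]
  have h0 : 0 ≤ b - ‖radialStep x₀ b (chainFactor ^ m) y - x₀‖ := by rw [hdep]; exact htm.le
  have h1 : b - ‖radialStep x₀ b (chainFactor ^ m) y - x₀‖ ≤ (b - a) / 2 := by rw [hdep]; linarith
  have h2 : b - ‖radialStep x₀ b (chainFactor ^ m) y - x₀‖ ≤ k⁻¹ := by rw [hdep]; linarith
  have hρT : whitneyRadius x₀ a b k (radialStep x₀ b (chainFactor ^ m) y) =
      chainFactor ^ m * (b - ‖y - x₀‖) / 100 := by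
    rw [whitneyRadius_eq_outer h0 h1 h2, hdep]
  refine ⟨by rw [hd]; exact htm, hρT, ?_⟩
  rw [hρT, whitneyRadius_eq_outer ht0.le (by linarith) (by linarith)]
  field_simp

/-- **The increment at a small outer iterate, pointwise**: for `y` on the outer layer with
`λᵐ t < k⁻¹/2`, `ρ(y) J(T^m y)³ ≤ 12996 C_W λ⁻ᵐ Φ(T^m y)`. [cite: Tao2011, §10, proof of Thm. 10.1 (p. 33)] -/
theorem outer_incr_pointwise (ha : 0 < a) (hk : 0 < k) (hab : a + 2 * k⁻¹ < b) {u : ℝ³ → ℝ³}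
    (hu : ContDiff ℝ 2 u) {y : ℝ³} (hy : ‖y - x₀‖ < b) (m : ℕ)
    (hm : chainFactor ^ m * (b - ‖y - x₀‖) < k⁻¹ / 2) :
    ENNReal.ofReal (whitneyRadius x₀ a b k y) *
        chainIncr x₀ a b k (curl u) (radialStep x₀ b (chainFactor ^ m) y) ^ 3 ≤
      12996 * ENNReal.ofReal (bongConst k (localisedEnstrophy (fun x => annularRamp k a b ‖x - x₀‖) u)) *
        ENNReal.ofReal (chainFactor ^ m)⁻¹ * dissOverlap x₀ a b k u (radialStep x₀ b (chainFactor ^ m) y) := by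
  have hℓ0 : 0 < k⁻¹ := inv_pos.2 hk
  obtain ⟨hdz, hρz, hρy⟩ := outer_iterate (k := k) ha hk hab hy m (hm.trans (by linarith))
  set z := radialStep x₀ b (chainFactor ^ m) y with hz
  set ρ := whitneyRadius x₀ a b k with hρ
  set W := localisedEnstrophy (fun x => annularRamp k a b ‖x - x₀‖) u with hW
  have hρz0 : 0 < ρ z := whitneyRadius_pos hk hdz
  have hω : Continuous (curl u) := continuous_curl (hu.of_le (by norm_num))
  have hb : rmsE (curl u) z (ρ z) ≤ ENNReal.ofReal (bongConst k W * (ρ z)⁻¹ ^ 2) :=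
    rmsE_whitney_le (x₀ := x₀) (a := a) (b := b) hk hω hdz
  have hJ := min_pow_three_le (rmsE (curl u) z (ρ z)) (dissE (curl u) z (ρ z))
  rw [← chainIncr_def] at hJ
  have hbong0 : 0 ≤ bongConst k W := Real.sqrt_nonneg _
  calc ENNReal.ofReal (ρ y) * chainIncr x₀ a b k (curl u) z ^ 3
      ≤ ENNReal.ofReal (ρ y) * (12996 * rmsE (curl u) z (ρ z) * dissE (curl u) z (ρ z)) :=
        mul_le_mul' le_rfl hJ
    _ ≤ ENNReal.ofReal ((chainFactor ^ m)⁻¹ * ρ z) *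
          (12996 * ENNReal.ofReal (bongConst k W * (ρ z)⁻¹ ^ 2) * dissE (curl u) z (ρ z)) := by
        rw [hρy]; gcongr
    _ = 12996 * ENNReal.ofReal (bongConst k W) * ENNReal.ofReal (chainFactor ^ m)⁻¹ * dissOverlap x₀ a b k u z := by
        have hcf0 : 0 ≤ (chainFactor ^ m)⁻¹ := inv_nonneg.2 (pow_pos chainFactor_pos m).le
        have e1 : ENNReal.ofReal ((chainFactor ^ m)⁻¹ * ρ z) =
            ENNReal.ofReal (chainFactor ^ m)⁻¹ * ENNReal.ofReal (ρ z) := ENNReal.ofReal_mul hcf0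
        have e2 : ENNReal.ofReal (bongConst k W * (ρ z)⁻¹ ^ 2) =
            ENNReal.ofReal (bongConst k W) * ENNReal.ofReal ((ρ z)⁻¹ ^ 2) := ENNReal.ofReal_mul hbong0
        have e3 : ENNReal.ofReal (ρ z) * ENNReal.ofReal (ρ z)⁻¹ = 1 := by
          rw [← ENNReal.ofReal_mul hρz0.le, mul_inv_cancel₀ hρz0.ne', ENNReal.ofReal_one]
        rw [e1, e2, dissE_def, dissOverlap, ← hρ]
        calc ENNReal.ofReal (chainFactor ^ m)⁻¹ * ENNReal.ofReal (ρ z) *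
              (12996 * (ENNReal.ofReal (bongConst k W) * ENNReal.ofReal ((ρ z)⁻¹ ^ 2)) *
                (ENNReal.ofReal (ρ z)⁻¹ * ∫⁻ x in ball z (10 * ρ z), ‖fderiv ℝ (curl u) x‖ₑ ^ 2))
            = (ENNReal.ofReal (ρ z) * ENNReal.ofReal (ρ z)⁻¹) *
                (12996 * ENNReal.ofReal (bongConst k W) * ENNReal.ofReal (chainFactor ^ m)⁻¹ *
                  (ENNReal.ofReal ((ρ z)⁻¹ ^ 2) * ∫⁻ x in ball z (10 * ρ z), ‖fderiv ℝ (curl u) x‖ₑ ^ 2)) := by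
              ring
          _ = _ := by rw [e3, one_mul]

/-- **Outer term B at level `m`, integrated**: with `S_m = {b - λ⁻ᵐk⁻¹/2 < |y-x₀| < b}`,
`∫_{S_m} ρ(y) J(T^m y)³ dy ≤ 2 · 12996 C_W λ^{-2m} ∫ Φ` (the volume comparison along rays with
`K = 2`: on these shells `|T^m y - x₀| ≥ b - k⁻¹/2 ≥ 3b/4 ≥ (3/4)|y - x₀|`). [cite: Tao2011, §10, proof of Thm. 10.1 (p. 33)] -/
theorem outer_termB_le (ha : 0 < a) (hk : 0 < k) (hab : a + 2 * k⁻¹ < b) {u : ℝ³ → ℝ³}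
    (hu : ContDiff ℝ 2 u) (m : ℕ) :
    ∫⁻ y in openShell x₀ (b - (chainFactor ^ m)⁻¹ * (k⁻¹ / 2)) b,
        ENNReal.ofReal (whitneyRadius x₀ a b k y) *
          chainIncr x₀ a b k (curl u) (radialStep x₀ b (chainFactor ^ m) y) ^ 3 ≤
      2 * 12996 * ENNReal.ofReal (bongConst k (localisedEnstrophy (fun x => annularRamp k a b ‖x - x₀‖) u)) *
        ENNReal.ofReal ((chainFactor ^ m)⁻¹ ^ 2) * ∫⁻ z, dissOverlap x₀ a b k u z := by
  have hℓ : 0 < k⁻¹ := inv_pos.2 hk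
  set μm := chainFactor ^ m with hμm
  have hpow : 0 < μm := pow_pos chainFactor_pos m
  have hpow1 : 1 ≤ μm := one_le_pow₀ one_le_chainFactor
  have hμinv1 : μm⁻¹ ≤ 1 := inv_le_one_of_one_le₀ hpow1
  set S : Set ℝ³ := openShell x₀ (b - μm⁻¹ * (k⁻¹ / 2)) b with hS
  have hSm : MeasurableSet S := measurableSet_openShell x₀ _ _
  set C : ℝ≥0∞ := 12996 * ENNReal.ofReal (bongConst k (localisedEnstrophy (fun x => annularRamp k a b ‖x - x₀‖) u)) *
    ENNReal.ofReal μm⁻¹ with hC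
  have hpt : ∀ y ∈ S, ENNReal.ofReal (whitneyRadius x₀ a b k y) *
      chainIncr x₀ a b k (curl u) (radialStep x₀ b μm y) ^ 3 ≤ C * dissOverlap x₀ a b k u (radialStep x₀ b μm y) := by
    intro y hy
    rw [hS, mem_openShell] at hy
    have hy1 : ‖y - x₀‖ < b := hy.2
    have hm : μm * (b - ‖y - x₀‖) < k⁻¹ / 2 := by
      have : b - ‖y - x₀‖ < μm⁻¹ * (k⁻¹ / 2) := by linarith [hy.1]
      calc μm * (b - ‖y - x₀‖) < μm * (μm⁻¹ * (k⁻¹ / 2)) := mul_lt_mul_of_pos_left this hpow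
        _ = k⁻¹ / 2 := by field_simp
    exact outer_incr_pointwise ha hk hab hu hy1 m hm
  -- change of variables (`K = 2`)
  have hr₁ : 0 ≤ b - μm⁻¹ * (k⁻¹ / 2) := by
    have : μm⁻¹ * (k⁻¹ / 2) ≤ 1 * (k⁻¹ / 2) := mul_le_mul_of_nonneg_right hμinv1 (by positivity)
    linarith
  have hcv := lintegral_shell_comp_radialStep_le (x₀ := x₀) (p := b) (μ := μm)
    (measurable_dissOverlap x₀ a b k hu) hpow1 (r₁ := b - μm⁻¹ * (k⁻¹ / 2)) (r₂ := b) (K := 2) hr₁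
    zero_le_two (fun r hr => by
      have h1 : b - r < μm⁻¹ * (k⁻¹ / 2) := by linarith [hr.1]
      have h2 : μm * (b - r) < k⁻¹ / 2 := by
        calc μm * (b - r) < μm * (μm⁻¹ * (k⁻¹ / 2)) := mul_lt_mul_of_pos_left h1 hpow
          _ = k⁻¹ / 2 := by field_simp
      have h3 : 3 * b / 4 ≤ b + μm * (r - b) := by nlinarith
      have h4 : 0 ≤ r := by
        have : μm⁻¹ * (k⁻¹ / 2) ≤ 1 * (k⁻¹ / 2) := mul_le_mul_of_nonneg_right hμinv1 (by positivity)
        linarith [hr.1]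
      nlinarith [hr.2])
    (fun r hr => by
      have h1 : b - r < μm⁻¹ * (k⁻¹ / 2) := by linarith [hr.1]
      have h2 : μm * (b - r) < k⁻¹ / 2 := by
        calc μm * (b - r) < μm * (μm⁻¹ * (k⁻¹ / 2)) := mul_lt_mul_of_pos_left h1 hpow
          _ = k⁻¹ / 2 := by field_simp
      nlinarith)
  calc ∫⁻ y in S, ENNReal.ofReal (whitneyRadius x₀ a b k y) * chainIncr x₀ a b k (curl u) (radialStep x₀ b μm y) ^ 3
      ≤ ∫⁻ y in S, C * dissOverlap x₀ a b k u (radialStep x₀ b μm y) := setLIntegral_mono' hSm hpt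
    _ = C * ∫⁻ y in S, dissOverlap x₀ a b k u (radialStep x₀ b μm y) := by
        rw [lintegral_const_mul' _ _ (by rw [hC]; exact ENNReal.mul_ne_top (ENNReal.mul_ne_top (by norm_num) ENNReal.ofReal_ne_top) ENNReal.ofReal_ne_top)]
    _ ≤ C * (ENNReal.ofReal 2 * ENNReal.ofReal μm⁻¹ *
          ∫⁻ z in openShell x₀ (b + μm * (b - μm⁻¹ * (k⁻¹ / 2) - b)) (b + μm * (b - b)), dissOverlap x₀ a b k u z) :=
        mul_le_mul' le_rfl hcv
    _ ≤ C * (ENNReal.ofReal 2 * ENNReal.ofReal μm⁻¹ * ∫⁻ z, dissOverlap x₀ a b k u z) := by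
        gcongr
        exact Measure.restrict_le_self
    _ = 2 * 12996 * ENNReal.ofReal (bongConst k (localisedEnstrophy (fun x => annularRamp k a b ‖x - x₀‖) u)) *
          ENNReal.ofReal (μm⁻¹ ^ 2) * ∫⁻ z, dissOverlap x₀ a b k u z := by
        rw [hC, ENNReal.ofReal_ofNat, pow_two, ENNReal.ofReal_mul (by positivity)]
        ring

/-- **Outer term A at level `n`, integrated**: on the shell
`{b - λ⁻ⁿλk⁻¹/2 < |y-x₀| < b - λ⁻ⁿk⁻¹/4}`, `∫ ρ(y) w(Tⁿ y)³ dy ≤ 2λ^{-2n} ∫_{ρ ≥ (400k)⁻¹} ρ w³`.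
[cite: Tao2011, §10, proof of Thm. 10.1 (p. 33)] -/
theorem outer_termA_le (ha : 0 < a) (hk : 0 < k) (hab : a + 2 * k⁻¹ < b) {u : ℝ³ → ℝ³}
    (hu : ContDiff ℝ 2 u) (n : ℕ) :
    ∫⁻ y in openShell x₀ (b - (chainFactor ^ n)⁻¹ * (chainFactor * k⁻¹ / 2)) (b - (chainFactor ^ n)⁻¹ * (k⁻¹ / 4)),
        ENNReal.ofReal (whitneyRadius x₀ a b k y) *
          rmsE (curl u) (radialStep x₀ b (chainFactor ^ n) y)
            (whitneyRadius x₀ a b k (radialStep x₀ b (chainFactor ^ n) y)) ^ 3 ≤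
      2 * ENNReal.ofReal ((chainFactor ^ n)⁻¹ ^ 2) *
        ∫⁻ z in {z | (400 * k)⁻¹ ≤ whitneyRadius x₀ a b k z}, chainDensity x₀ a b k u z := by
  have hℓ : 0 < k⁻¹ := inv_pos.2 hk
  set μn := chainFactor ^ n with hμn
  have hpow : 0 < μn := pow_pos chainFactor_pos n
  have hpow1 : 1 ≤ μn := one_le_pow₀ one_le_chainFactor
  have hμinv1 : μn⁻¹ ≤ 1 := inv_le_one_of_one_le₀ hpow1
  have hlam : chainFactor = 103 / 100 := chainFactor_eq
  set S : Set ℝ³ := openShell x₀ (b - μn⁻¹ * (chainFactor * k⁻¹ / 2)) (b - μn⁻¹ * (k⁻¹ / 4)) with hS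
  have hSm : MeasurableSet S := measurableSet_openShell x₀ _ _
  have hpt : ∀ y ∈ S, ENNReal.ofReal (whitneyRadius x₀ a b k y) *
      rmsE (curl u) (radialStep x₀ b μn y) (whitneyRadius x₀ a b k (radialStep x₀ b μn y)) ^ 3 ≤
      ENNReal.ofReal μn⁻¹ * chainDensity x₀ a b k u (radialStep x₀ b μn y) := by
    intro y hy
    rw [hS, mem_openShell] at hy
    have hy1 : ‖y - x₀‖ < b := by
      have : 0 < μn⁻¹ * (k⁻¹ / 4) := by positivity
      linarith [hy.2]
    have hm : μn * (b - ‖y - x₀‖) < k⁻¹ := by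
      have : b - ‖y - x₀‖ < μn⁻¹ * (chainFactor * k⁻¹ / 2) := by linarith [hy.1]
      calc μn * (b - ‖y - x₀‖) < μn * (μn⁻¹ * (chainFactor * k⁻¹ / 2)) := mul_lt_mul_of_pos_left this hpow
        _ = chainFactor * k⁻¹ / 2 := by field_simp
        _ < k⁻¹ := by rw [hlam]; linarith
    obtain ⟨-, -, hρy⟩ := outer_iterate (k := k) ha hk hab hy1 n hm
    rw [← hμn] at hρy
    rw [hρy, ENNReal.ofReal_mul (inv_nonneg.2 hpow.le), mul_assoc, chainDensity]
  -- change of variables (`K = 2`)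
  have hr₁ : 0 ≤ b - μn⁻¹ * (chainFactor * k⁻¹ / 2) := by
    have : μn⁻¹ * (chainFactor * k⁻¹ / 2) ≤ 1 * (chainFactor * k⁻¹ / 2) :=
      mul_le_mul_of_nonneg_right hμinv1 (div_nonneg (mul_nonneg chainFactor_pos.le hℓ.le) zero_le_two)
    rw [hlam] at this ⊢; nlinarith
  have hcv := lintegral_shell_comp_radialStep_le (x₀ := x₀) (p := b) (μ := μn)
    (measurable_chainDensity x₀ a b k hu) hpow1
    (r₁ := b - μn⁻¹ * (chainFactor * k⁻¹ / 2)) (r₂ := b - μn⁻¹ * (k⁻¹ / 4)) (K := 2) hr₁ zero_le_two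
    (fun r hr => by
      have h1 : b - r < μn⁻¹ * (chainFactor * k⁻¹ / 2) := by linarith [hr.1]
      have h2 : μn * (b - r) < chainFactor * k⁻¹ / 2 := by
        calc μn * (b - r) < μn * (μn⁻¹ * (chainFactor * k⁻¹ / 2)) := mul_lt_mul_of_pos_left h1 hpow
          _ = chainFactor * k⁻¹ / 2 := by field_simp
      have h3 : 18 * b / 25 ≤ b + μn * (r - b) := by rw [hlam] at h2; nlinarith
      have h4 : 0 ≤ r := by
        have : μn⁻¹ * (chainFactor * k⁻¹ / 2) ≤ 1 * (chainFactor * k⁻¹ / 2) :=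
          mul_le_mul_of_nonneg_right hμinv1 (div_nonneg (mul_nonneg chainFactor_pos.le hℓ.le) zero_le_two)
        rw [hlam] at this; nlinarith [hr.1]
      have h5 : r ≤ b := by
        have : 0 < μn⁻¹ * (k⁻¹ / 4) := by positivity
        linarith [hr.2]
      nlinarith)
    (fun r hr => by
      have h1 : b - r < μn⁻¹ * (chainFactor * k⁻¹ / 2) := by linarith [hr.1]
      have h2 : μn * (b - r) < chainFactor * k⁻¹ / 2 := by
        calc μn * (b - r) < μn * (μn⁻¹ * (chainFactor * k⁻¹ / 2)) := mul_lt_mul_of_pos_left h1 hpow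
          _ = chainFactor * k⁻¹ / 2 := by field_simp
      rw [hlam] at h2; nlinarith)
  -- the image shell lies in the large region
  have himg : openShell x₀ (b + μn * (b - μn⁻¹ * (chainFactor * k⁻¹ / 2) - b)) (b + μn * (b - μn⁻¹ * (k⁻¹ / 4) - b)) ⊆
      {z | (400 * k)⁻¹ ≤ whitneyRadius x₀ a b k z} := by
    intro z hz
    rw [mem_openShell] at hz
    have e1 : b + μn * (b - μn⁻¹ * (chainFactor * k⁻¹ / 2) - b) = b - chainFactor * k⁻¹ / 2 := by
      field_simp; ring
    have e2 : b + μn * (b - μn⁻¹ * (k⁻¹ / 4) - b) = b - k⁻¹ / 4 := by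
      field_simp; ring
    rw [e1, e2] at hz
    have ht0 : 0 ≤ b - ‖z - x₀‖ := by
      have : 0 < k⁻¹ / 4 := by positivity
      linarith [hz.2]
    have ht1 : b - ‖z - x₀‖ ≤ (b - a) / 2 := by rw [hlam] at hz; linarith [hz.1]
    have ht2 : b - ‖z - x₀‖ ≤ k⁻¹ := by rw [hlam] at hz; linarith [hz.1]
    show (400 * k)⁻¹ ≤ whitneyRadius x₀ a b k z
    rw [whitneyRadius_eq_outer ht0 ht1 ht2]
    rw [show (400 * k)⁻¹ = k⁻¹ / 4 / 100 by field_simp; ring]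
    exact div_le_div_of_nonneg_right (by linarith [hz.2]) (by norm_num)
  calc ∫⁻ y in S, ENNReal.ofReal (whitneyRadius x₀ a b k y) *
          rmsE (curl u) (radialStep x₀ b μn y) (whitneyRadius x₀ a b k (radialStep x₀ b μn y)) ^ 3
      ≤ ∫⁻ y in S, ENNReal.ofReal μn⁻¹ * chainDensity x₀ a b k u (radialStep x₀ b μn y) := setLIntegral_mono' hSm hpt
    _ = ENNReal.ofReal μn⁻¹ * ∫⁻ y in S, chainDensity x₀ a b k u (radialStep x₀ b μn y) :=
        lintegral_const_mul' _ _ ENNReal.ofReal_ne_top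
    _ ≤ ENNReal.ofReal μn⁻¹ * (ENNReal.ofReal 2 * ENNReal.ofReal μn⁻¹ *
          ∫⁻ z in openShell x₀ (b + μn * (b - μn⁻¹ * (chainFactor * k⁻¹ / 2) - b))
            (b + μn * (b - μn⁻¹ * (k⁻¹ / 4) - b)), chainDensity x₀ a b k u z) :=
        mul_le_mul' le_rfl hcv
    _ ≤ ENNReal.ofReal μn⁻¹ * (ENNReal.ofReal 2 * ENNReal.ofReal μn⁻¹ *
          ∫⁻ z in {z | (400 * k)⁻¹ ≤ whitneyRadius x₀ a b k z}, chainDensity x₀ a b k u z) :=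
        mul_le_mul' le_rfl (mul_le_mul' le_rfl (lintegral_mono_set himg))
    _ = 2 * ENNReal.ofReal (μn⁻¹ ^ 2) * ∫⁻ z in {z | (400 * k)⁻¹ ≤ whitneyRadius x₀ a b k z}, chainDensity x₀ a b k u z := by
        rw [ENNReal.ofReal_ofNat, pow_two, ENNReal.ofReal_mul (inv_nonneg.2 hpow.le)]
        ring

end OuterChain

/-! ### The outer layer: from the chain to the two terms -/

section OuterSmall

variable {x₀ : ℝ³} {a b k : ℝ}

/-- The `n`-th outer term of type A: `1_{Sh_{n+1}}(y) ρ(y) w(Tⁿ⁺¹ y)³`. [folklore] -/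
def outerTermA (x₀ : ℝ³) (a b k : ℝ) (u : ℝ³ → ℝ³) (n : ℕ) (y : ℝ³) : ℝ≥0∞ :=
  (openShell x₀ (b - (chainFactor ^ (n + 1))⁻¹ * (chainFactor * k⁻¹ / 2))
      (b - (chainFactor ^ (n + 1))⁻¹ * (k⁻¹ / 4))).indicator
    (fun y => ENNReal.ofReal (whitneyRadius x₀ a b k y) *
      rmsE (curl u) (radialStep x₀ b (chainFactor ^ (n + 1)) y)
        (whitneyRadius x₀ a b k (radialStep x₀ b (chainFactor ^ (n + 1)) y)) ^ 3) y

/-- The `m`-th outer term of type B: `s^{2m} 1_{S_m}(y) ρ(y) J(Tᵐ y)³`. [folklore] -/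
def outerTermB (x₀ : ℝ³) (a b k : ℝ) (u : ℝ³ → ℝ³) (m : ℕ) (y : ℝ³) : ℝ≥0∞ :=
  ENNReal.ofReal (chainWeight ^ (2 * m)) *
    (openShell x₀ (b - (chainFactor ^ m)⁻¹ * (k⁻¹ / 2)) b).indicator
      (fun y => ENNReal.ofReal (whitneyRadius x₀ a b k y) *
        chainIncr x₀ a b k (curl u) (radialStep x₀ b (chainFactor ^ m) y) ^ 3) y

/-- Measurability of the outer terms of type A. [folklore] -/
theorem measurable_outerTermA (x₀ : ℝ³) (a b k : ℝ) {u : ℝ³ → ℝ³} (hu : ContDiff ℝ 2 u) (n : ℕ) :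
    Measurable (outerTermA x₀ a b k u n) := by
  have hω : Continuous (curl u) := continuous_curl (hu.of_le (by norm_num))
  unfold outerTermA
  refine Measurable.indicator ?_ (measurableSet_openShell x₀ _ _)
  exact (continuous_whitneyRadius x₀ a b k).measurable.ennreal_ofReal.mul
    (((measurable_rmsE_var hω (continuous_whitneyRadius x₀ a b k)).comp
      (measurable_radialStep x₀ b _)).pow_const 3)

/-- Measurability of the outer terms of type B. [folklore] -/
theorem measurable_outerTermB (x₀ : ℝ³) (a b k : ℝ) {u : ℝ³ → ℝ³} (hu : ContDiff ℝ 2 u) (m : ℕ) :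
    Measurable (outerTermB x₀ a b k u m) := by
  unfold outerTermB
  refine measurable_const.mul (Measurable.indicator ?_ (measurableSet_openShell x₀ _ _))
  exact (continuous_whitneyRadius x₀ a b k).measurable.ennreal_ofReal.mul
    (((measurable_chainIncr x₀ a b k hu).comp (measurable_radialStep x₀ b _)).pow_const 3)

/-- **The chain at a point of the outer layer** (telescoping to the first large iterate, cubes with
geometric Hölder weights): for `0 < b - |y - x₀| < k⁻¹/2`,
`ρ(y) w(y)³ ≤ 4 Σₙ A_n(y) + 40804 Σₘ B_m(y)` (outer terms). [cite: Tao2011, §10, proof of Thm. 10.1 (p. 33, "w_i³ ≲ w_{a(i)}³ + Σ_{k≥0}(1+k)^{10}|w_{pᵏ(i)} − w_{pᵏ⁺¹(i)}|³")] -/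
theorem outer_pointwise (ha : 0 < a) (hk : 0 < k) (hab : a + 2 * k⁻¹ < b) {u : ℝ³ → ℝ³}
    (hu : ContDiff ℝ 2 u) {y : ℝ³} (hy1 : ‖y - x₀‖ < b) (hy2 : b - ‖y - x₀‖ < k⁻¹ / 2) :
    chainDensity x₀ a b k u y ≤
      4 * (∑' n, outerTermA x₀ a b k u n y) + 40804 * ∑' m, outerTermB x₀ a b k u m y := by
  classical
  have hℓ : 0 < k⁻¹ := inv_pos.2 hk
  have ht0 : 0 < b - ‖y - x₀‖ := by linarith
  have hω1 : ContDiff ℝ 1 (curl u) := contDiff_curl (n := 1) hu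
  set t := b - ‖y - x₀‖ with ht
  -- the chain length
  have hex : ∃ m : ℕ, k⁻¹ / 2 ≤ chainFactor ^ m * t := by
    obtain ⟨m, hm⟩ := pow_unbounded_of_one_lt (k⁻¹ / 2 / t) one_lt_chainFactor
    refine ⟨m, ?_⟩
    rw [div_lt_iff₀ ht0] at hm
    exact hm.le
  set M := Nat.find hex with hMdef
  have hM : k⁻¹ / 2 ≤ chainFactor ^ M * t := Nat.find_spec hex
  have hmin : ∀ m < M, chainFactor ^ m * t < k⁻¹ / 2 := fun m hm => lt_of_not_ge (Nat.find_min hex hm)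
  have hM0 : M ≠ 0 := by
    intro h
    have := hM
    rw [h, pow_zero, one_mul] at this
    linarith
  obtain ⟨M', hM'0⟩ := Nat.exists_eq_succ_of_ne_zero hM0
  have hM' : M = M' + 1 := hM'0
  -- telescoping and cubes
  have htele := rmsE_le_rmsE_outerIterate_add_sum (a := a) ha hk hab hω1 hy1 hy2 M hmin
  set A := rmsE (curl u) (radialStep x₀ b (chainFactor ^ M) y)
    (whitneyRadius x₀ a b k (radialStep x₀ b (chainFactor ^ M) y)) with hA
  set J : ℕ → ℝ≥0∞ := fun m => chainIncr x₀ a b k (curl u) (radialStep x₀ b (chainFactor ^ m) y) with hJ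
  have hcube : rmsE (curl u) y (whitneyRadius x₀ a b k y) ^ 3 ≤
      4 * A ^ 3 + 40804 * ∑ m ∈ Finset.range M, ENNReal.ofReal (chainWeight ^ (2 * m)) * J m ^ 3 := by
    calc rmsE (curl u) y (whitneyRadius x₀ a b k y) ^ 3
        ≤ (A + ∑ m ∈ Finset.range M, J m) ^ 3 := pow_le_pow_left' htele 3
      _ ≤ 4 * A ^ 3 + 4 * (∑ m ∈ Finset.range M, J m) ^ 3 := y6_add_pow_three_le _ _
      _ ≤ 4 * A ^ 3 + 4 * (10201 * ∑ m ∈ Finset.range M, ENNReal.ofReal (chainWeight ^ (2 * m)) * J m ^ 3) := by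
          gcongr
          exact cube_sum_le_weighted J M
      _ = _ := by ring
  -- membership of `y` in the shells
  have hpowM : 0 < chainFactor ^ M := pow_pos chainFactor_pos M
  have hyA : y ∈ openShell x₀ (b - (chainFactor ^ (M' + 1))⁻¹ * (chainFactor * k⁻¹ / 2))
      (b - (chainFactor ^ (M' + 1))⁻¹ * (k⁻¹ / 4)) := by
    rw [← hM', mem_openShell]
    constructor
    · -- `λ^{M'} t < ℓ/2`
      have h1 : chainFactor ^ M' * t < k⁻¹ / 2 := hmin M' (by rw [hM']; exact Nat.lt_succ_self M')
      have h2 : t < (chainFactor ^ M)⁻¹ * (chainFactor * k⁻¹ / 2) := by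
        rw [lt_inv_mul_iff₀ hpowM, hM', pow_succ]
        nlinarith [chainFactor_pos]
      rw [ht] at h2; linarith
    · -- `t ≥ λ^{-M} ℓ/2 > λ^{-M} ℓ/4`
      have h1 : (chainFactor ^ M)⁻¹ * (k⁻¹ / 2) ≤ t := by
        rw [inv_mul_le_iff₀ hpowM]; exact hM
      have h2 : (chainFactor ^ M)⁻¹ * (k⁻¹ / 4) < (chainFactor ^ M)⁻¹ * (k⁻¹ / 2) :=
        mul_lt_mul_of_pos_left (by linarith) (inv_pos.2 hpowM)
      rw [ht] at h1; linarith
  have hyB : ∀ m < M, y ∈ openShell x₀ (b - (chainFactor ^ m)⁻¹ * (k⁻¹ / 2)) b := by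
    intro m hm
    rw [mem_openShell]
    refine ⟨?_, hy1⟩
    have h1 := hmin m hm
    have h2 : t < (chainFactor ^ m)⁻¹ * (k⁻¹ / 2) := by
      rw [lt_inv_mul_iff₀ (pow_pos chainFactor_pos m)]; exact h1
    rw [ht] at h2; linarith
  -- the A-term is one term of the A-series
  have hAterm : ENNReal.ofReal (whitneyRadius x₀ a b k y) * A ^ 3 ≤ ∑' n, outerTermA x₀ a b k u n y := by
    calc ENNReal.ofReal (whitneyRadius x₀ a b k y) * A ^ 3 = outerTermA x₀ a b k u M' y := by
          rw [outerTermA, indicator_of_mem hyA, hA, hM']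
      _ ≤ ∑' n, outerTermA x₀ a b k u n y := ENNReal.le_tsum M'
  -- the B-terms are terms of the B-series
  have hBterm : ∑ m ∈ Finset.range M, ENNReal.ofReal (chainWeight ^ (2 * m)) *
      (ENNReal.ofReal (whitneyRadius x₀ a b k y) * J m ^ 3) ≤ ∑' m, outerTermB x₀ a b k u m y := by
    calc ∑ m ∈ Finset.range M, ENNReal.ofReal (chainWeight ^ (2 * m)) *
          (ENNReal.ofReal (whitneyRadius x₀ a b k y) * J m ^ 3)
        = ∑ m ∈ Finset.range M, outerTermB x₀ a b k u m y := by
          refine Finset.sum_congr rfl fun m hm => ?_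
          rw [outerTermB, indicator_of_mem (hyB m (Finset.mem_range.1 hm))]
      _ ≤ ∑' m, outerTermB x₀ a b k u m y := ENNReal.sum_le_tsum _
  -- assemble
  calc chainDensity x₀ a b k u y
      = ENNReal.ofReal (whitneyRadius x₀ a b k y) * rmsE (curl u) y (whitneyRadius x₀ a b k y) ^ 3 := rfl
    _ ≤ ENNReal.ofReal (whitneyRadius x₀ a b k y) *
          (4 * A ^ 3 + 40804 * ∑ m ∈ Finset.range M, ENNReal.ofReal (chainWeight ^ (2 * m)) * J m ^ 3) :=
        mul_le_mul' le_rfl hcube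
    _ = 4 * (ENNReal.ofReal (whitneyRadius x₀ a b k y) * A ^ 3) +
          40804 * ∑ m ∈ Finset.range M, ENNReal.ofReal (chainWeight ^ (2 * m)) *
            (ENNReal.ofReal (whitneyRadius x₀ a b k y) * J m ^ 3) := by
        rw [mul_add, Finset.mul_sum, Finset.mul_sum, Finset.mul_sum]
        congr 1
        · ring
        · refine Finset.sum_congr rfl fun m _ => ?_; ring
    _ ≤ 4 * (∑' n, outerTermA x₀ a b k u n y) + 40804 * ∑' m, outerTermB x₀ a b k u m y := by
        gcongr

/-- **The outer layer, integrated**: `∫_{0<b-|y-x₀|<k⁻¹/2} ρ w³ ≤ 4 Σₙ ∫A_n + 40804 Σₘ ∫B_m`.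
[cite: Tao2011, §10, proof of Thm. 10.1 (p. 33)] -/
theorem outer_small_le (ha : 0 < a) (hk : 0 < k) (hab : a + 2 * k⁻¹ < b) {u : ℝ³ → ℝ³}
    (hu : ContDiff ℝ 2 u) :
    ∫⁻ y in openShell x₀ (b - k⁻¹ / 2) b, chainDensity x₀ a b k u y ≤
      4 * (∑' n, ∫⁻ y, outerTermA x₀ a b k u n y) + 40804 * ∑' m, ∫⁻ y, outerTermB x₀ a b k u m y := by
  have hSm : MeasurableSet (openShell x₀ (b - k⁻¹ / 2) b) := measurableSet_openShell x₀ _ _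
  have hpt : ∀ y ∈ openShell x₀ (b - k⁻¹ / 2) b, chainDensity x₀ a b k u y ≤
      4 * (∑' n, outerTermA x₀ a b k u n y) + 40804 * ∑' m, outerTermB x₀ a b k u m y := by
    intro y hy
    rw [mem_openShell] at hy
    exact outer_pointwise ha hk hab hu hy.2 (by linarith [hy.1])
  have hA : ∀ n, AEMeasurable (outerTermA x₀ a b k u n) volume := fun n =>
    (measurable_outerTermA x₀ a b k hu n).aemeasurable
  have hB : ∀ m, AEMeasurable (outerTermB x₀ a b k u m) volume := fun m =>
    (measurable_outerTermB x₀ a b k hu m).aemeasurable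
  have hmA : AEMeasurable (fun y => ∑' n, outerTermA x₀ a b k u n y) volume := AEMeasurable.tsum hA
  have hmB : AEMeasurable (fun y => ∑' m, outerTermB x₀ a b k u m y) volume := AEMeasurable.tsum hB
  calc ∫⁻ y in openShell x₀ (b - k⁻¹ / 2) b, chainDensity x₀ a b k u y
      ≤ ∫⁻ y in openShell x₀ (b - k⁻¹ / 2) b,
          (4 * (∑' n, outerTermA x₀ a b k u n y) + 40804 * ∑' m, outerTermB x₀ a b k u m y) :=
        setLIntegral_mono' hSm hpt
    _ ≤ ∫⁻ y, (4 * (∑' n, outerTermA x₀ a b k u n y) + 40804 * ∑' m, outerTermB x₀ a b k u m y) :=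
        setLIntegral_le_lintegral _ _
    _ = (4 * ∫⁻ y, ∑' n, outerTermA x₀ a b k u n y) + 40804 * ∫⁻ y, ∑' m, outerTermB x₀ a b k u m y := by
        rw [lintegral_add_left' (hmA.const_mul 4), lintegral_const_mul'' _ hmA, lintegral_const_mul'' _ hmB]
    _ = 4 * (∑' n, ∫⁻ y, outerTermA x₀ a b k u n y) + 40804 * ∑' m, ∫⁻ y, outerTermB x₀ a b k u m y := by
        rw [lintegral_tsum hA, lintegral_tsum hB]

end OuterSmall

/-! ### The outer layer, total -/

section OuterTotal

variable {x₀ : ℝ³} {a b k : ℝ}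

/-- **The outer layer, total**: `∫_{0<b-|y-x₀|<k⁻¹/2} ρ w³ ≤ 144 ∫_{ρ≥(400k)⁻¹} ρ w³ + 40804·12996·54 C_W ∫ Φ`.
[cite: Tao2011, §10, proof of Thm. 10.1 (p. 33)] -/
theorem outer_total_le (ha : 0 < a) (hk : 0 < k) (hab : a + 2 * k⁻¹ < b) {u : ℝ³ → ℝ³}
    (hu : ContDiff ℝ 2 u) :
    ∫⁻ y in openShell x₀ (b - k⁻¹ / 2) b, chainDensity x₀ a b k u y ≤
      144 * (∫⁻ z in {z | (400 * k)⁻¹ ≤ whitneyRadius x₀ a b k z}, chainDensity x₀ a b k u z) +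
        40804 * 12996 * 54 *
          ENNReal.ofReal (bongConst k (localisedEnstrophy (fun x => annularRamp k a b ‖x - x₀‖) u)) *
            ∫⁻ z, dissOverlap x₀ a b k u z := by
  set IL := ∫⁻ z in {z | (400 * k)⁻¹ ≤ whitneyRadius x₀ a b k z}, chainDensity x₀ a b k u z with hIL
  set IΦ := ∫⁻ z, dissOverlap x₀ a b k u z with hIΦ
  set CW := ENNReal.ofReal (bongConst k (localisedEnstrophy (fun x => annularRamp k a b ‖x - x₀‖) u)) with hCW
  have hA : ∀ n, ∫⁻ y, outerTermA x₀ a b k u n y ≤ ENNReal.ofReal ((chainFactor ^ (n + 1))⁻¹ ^ 2) * (2 * IL) := by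
    intro n
    have e : (fun y => outerTermA x₀ a b k u n y) =
        (openShell x₀ (b - (chainFactor ^ (n + 1))⁻¹ * (chainFactor * k⁻¹ / 2))
          (b - (chainFactor ^ (n + 1))⁻¹ * (k⁻¹ / 4))).indicator
        (fun y => ENNReal.ofReal (whitneyRadius x₀ a b k y) *
          rmsE (curl u) (radialStep x₀ b (chainFactor ^ (n + 1)) y)
            (whitneyRadius x₀ a b k (radialStep x₀ b (chainFactor ^ (n + 1)) y)) ^ 3) := rfl
    rw [e, lintegral_indicator (measurableSet_openShell x₀ _ _)]
    calc _ ≤ 2 * ENNReal.ofReal ((chainFactor ^ (n + 1))⁻¹ ^ 2) * IL := outer_termA_le ha hk hab hu (n + 1)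
      _ = _ := by ring
  have hB : ∀ m, ∫⁻ y, outerTermB x₀ a b k u m y ≤
      ENNReal.ofReal (chainWeight ^ (2 * m)) * ENNReal.ofReal ((chainFactor ^ m)⁻¹ ^ 2) * (2 * 12996 * CW * IΦ) := by
    intro m
    have e : (fun y => outerTermB x₀ a b k u m y) = fun y => ENNReal.ofReal (chainWeight ^ (2 * m)) *
        (openShell x₀ (b - (chainFactor ^ m)⁻¹ * (k⁻¹ / 2)) b).indicator
          (fun y => ENNReal.ofReal (whitneyRadius x₀ a b k y) *
            chainIncr x₀ a b k (curl u) (radialStep x₀ b (chainFactor ^ m) y) ^ 3) y := rfl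
    rw [e, lintegral_const_mul' _ _ ENNReal.ofReal_ne_top, lintegral_indicator (measurableSet_openShell x₀ _ _)]
    calc ENNReal.ofReal (chainWeight ^ (2 * m)) *
          ∫⁻ y in openShell x₀ (b - (chainFactor ^ m)⁻¹ * (k⁻¹ / 2)) b,
            ENNReal.ofReal (whitneyRadius x₀ a b k y) * chainIncr x₀ a b k (curl u) (radialStep x₀ b (chainFactor ^ m) y) ^ 3
        ≤ ENNReal.ofReal (chainWeight ^ (2 * m)) * (2 * 12996 * CW * ENNReal.ofReal ((chainFactor ^ m)⁻¹ ^ 2) * IΦ) :=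
          mul_le_mul' le_rfl (outer_termB_le ha hk hab hu m)
      _ = _ := by ring
  calc ∫⁻ y in openShell x₀ (b - k⁻¹ / 2) b, chainDensity x₀ a b k u y
      ≤ 4 * (∑' n, ∫⁻ y, outerTermA x₀ a b k u n y) + 40804 * ∑' m, ∫⁻ y, outerTermB x₀ a b k u m y :=
        outer_small_le ha hk hab hu
    _ ≤ 4 * (∑' n, ENNReal.ofReal ((chainFactor ^ (n + 1))⁻¹ ^ 2) * (2 * IL)) +
          40804 * ∑' m, ENNReal.ofReal (chainWeight ^ (2 * m)) * ENNReal.ofReal ((chainFactor ^ m)⁻¹ ^ 2) *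
            (2 * 12996 * CW * IΦ) := by
        gcongr
        · exact hA _
        · exact hB _
    _ = 4 * ((∑' n, ENNReal.ofReal ((chainFactor ^ (n + 1))⁻¹ ^ 2)) * (2 * IL)) +
          40804 * ((∑' m, ENNReal.ofReal (chainWeight ^ (2 * m)) * ENNReal.ofReal ((chainFactor ^ m)⁻¹ ^ 2)) *
            (2 * 12996 * CW * IΦ)) := by
        rw [ENNReal.tsum_mul_right, ENNReal.tsum_mul_right]
    _ ≤ 4 * (18 * (2 * IL)) + 40804 * (27 * (2 * 12996 * CW * IΦ)) := by
        gcongr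
        · exact tsum_chainFactor_termA_le
        · exact tsum_chainWeight_termB_le
    _ = 144 * IL + 40804 * 12996 * 54 * CW * IΦ := by ring

end OuterTotal

/-! ### The chain bound -/

section Final

variable {x₀ : ℝ³} {a b k : ℝ}

/-- **The cover of the support of `ρ w³`**: a point with `ρ(y) > 0` lies in the inner layer, the
outer layer, or the large region `{ρ ≥ (400k)⁻¹}`. [folklore] -/
theorem chainDensity_le_indicator_add (hk : 0 < k) (u : ℝ³ → ℝ³) (y : ℝ³) :
    chainDensity x₀ a b k u y ≤
      (openShell x₀ a (a + k⁻¹ / 2)).indicator (chainDensity x₀ a b k u) y +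
        (openShell x₀ (b - k⁻¹ / 2) b).indicator (chainDensity x₀ a b k u) y +
        {z | (400 * k)⁻¹ ≤ whitneyRadius x₀ a b k z}.indicator (chainDensity x₀ a b k u) y := by
  have hℓ : 0 < k⁻¹ := inv_pos.2 hk
  by_cases hd : annDepth x₀ a b y ≤ 0
  · have : chainDensity x₀ a b k u y = 0 := by
      rw [chainDensity, whitneyRadius_eq_zero hd, ENNReal.ofReal_zero, zero_mul]
    rw [this]; exact bot_le
  · rw [not_le, annDepth_pos_iff] at hd
    by_cases h1 : ‖y - x₀‖ < a + k⁻¹ / 2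
    · have hy : y ∈ openShell x₀ a (a + k⁻¹ / 2) := (mem_openShell).2 ⟨hd.1, h1⟩
      rw [indicator_of_mem hy]
      calc chainDensity x₀ a b k u y ≤ chainDensity x₀ a b k u y + _ := le_self_add
        _ ≤ _ := le_self_add
    · by_cases h2 : b - k⁻¹ / 2 < ‖y - x₀‖
      · have hy : y ∈ openShell x₀ (b - k⁻¹ / 2) b := (mem_openShell).2 ⟨h2, hd.2⟩
        rw [indicator_of_mem hy]
        calc chainDensity x₀ a b k u y ≤ _ + chainDensity x₀ a b k u y := le_add_self
          _ ≤ _ := le_self_add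
      · rw [not_lt] at h1 h2
        have hy : y ∈ {z | (400 * k)⁻¹ ≤ whitneyRadius x₀ a b k z} := by
          show (400 * k)⁻¹ ≤ whitneyRadius x₀ a b k y
          have hdk : k⁻¹ / 2 ≤ min (annDepth x₀ a b y) k⁻¹ := by
            refine le_min ?_ (by linarith)
            rw [annDepth_def]
            exact le_min (by linarith) (by linarith)
          rw [whitneyRadius_def, max_eq_right (le_trans (by positivity) hdk),
            show (400 * k)⁻¹ = k⁻¹ / 4 / 100 by field_simp; ring]
          exact div_le_div_of_nonneg_right (by linarith) (by norm_num)
        rw [indicator_of_mem hy]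
        exact le_add_self

/-- **The chain bound, explicit form**: `∫ ρ w³ ≤ 217 ∫_{ρ≥(400k)⁻¹} ρ w³ + 40804·12996·81 C_W ∫ Φ`.
[cite: Tao2011, §10, proof of Thm. 10.1 (p. 33, the small balls)] -/
theorem lintegral_chainDensity_le (ha : 0 < a) (hk : 0 < k) (hab : a + 2 * k⁻¹ < b) {u : ℝ³ → ℝ³}
    (hu : ContDiff ℝ 2 u) :
    ∫⁻ y, chainDensity x₀ a b k u y ≤
      217 * (∫⁻ z in {z | (400 * k)⁻¹ ≤ whitneyRadius x₀ a b k z}, chainDensity x₀ a b k u z) +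
        40804 * 12996 * 81 *
          ENNReal.ofReal (bongConst k (localisedEnstrophy (fun x => annularRamp k a b ‖x - x₀‖) u)) *
            ∫⁻ z, dissOverlap x₀ a b k u z := by
  set Ψ := chainDensity x₀ a b k u with hΨ
  have hΨm : Measurable Ψ := measurable_chainDensity x₀ a b k hu
  set Sin : Set ℝ³ := openShell x₀ a (a + k⁻¹ / 2) with hSin
  set Sout : Set ℝ³ := openShell x₀ (b - k⁻¹ / 2) b with hSout
  set L : Set ℝ³ := {z | (400 * k)⁻¹ ≤ whitneyRadius x₀ a b k z} with hL
  have hSinm : MeasurableSet Sin := measurableSet_openShell x₀ _ _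
  have hSoutm : MeasurableSet Sout := measurableSet_openShell x₀ _ _
  have hLm : MeasurableSet L := (isClosed_le continuous_const (continuous_whitneyRadius x₀ a b k)).measurableSet
  set IL := ∫⁻ z in L, Ψ z with hIL
  set IΦ := ∫⁻ z, dissOverlap x₀ a b k u z with hIΦ
  set CW := ENNReal.ofReal (bongConst k (localisedEnstrophy (fun x => annularRamp k a b ‖x - x₀‖) u)) with hCW
  calc ∫⁻ y, Ψ y ≤ ∫⁻ y, (Sin.indicator Ψ y + Sout.indicator Ψ y + L.indicator Ψ y) :=
        lintegral_mono fun y => chainDensity_le_indicator_add hk u y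
    _ = (∫⁻ y in Sin, Ψ y) + (∫⁻ y in Sout, Ψ y) + IL := by
        rw [lintegral_add_right _ (hΨm.indicator hLm), lintegral_add_left (hΨm.indicator hSinm),
          lintegral_indicator hSinm, lintegral_indicator hSoutm, lintegral_indicator hLm]
    _ ≤ (72 * IL + 40804 * 12996 * 27 * CW * IΦ) + (144 * IL + 40804 * 12996 * 54 * CW * IΦ) + IL := by
        gcongr
        · exact inner_total_le ha hk hab hu
        · exact outer_total_le ha hk hab hu
    _ = 217 * IL + 40804 * 12996 * 81 * CW * IΦ := by ring

/-- **The chain bound for the continuous Whitney family** (Tao 2011, §10, proof of Thm. 10.1, p. 33: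
the small balls `wᵢ³ ≲ w_{a(i)}³ + Σ(1+k)^{10}|w_{pᵏ(i)} − w_{pᵏ⁺¹(i)}|³`, `Σ_{i:a(i)=j} rᵢ⁴ ≲ rⱼ⁴`,
`Σ_k (1+k)^{10} Σ_{i:pᵏ(i)=j} rᵢ⁴ ≲ rⱼ⁴`, combined with the large balls and (10.20), (10.22), (10.23)):
there is an absolute constant `C` such that for every annulus `{a < |x - x₀| < b}` with `0 < a`,
`a + 2k⁻¹ < b`, `0 < k`, and every `C²` velocity field `u` (`ω = curl u`, `ρ` the Whitney radius,
`w(y) = ρ(y)^{-3/2}‖ω‖_{L²(B(y,3ρ(y)))}`, `W = ½∫|ω|²η`, `Y₁ = ∫|∇ω|²η`, `η` the annular ramp of slope `k`),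
`∫ ρ(y) w(y)³ dy ≤ C √(2W/(97k)) (k W + k⁻¹ Y₁)`
(in Tao's normalisation `Σᵢ wᵢ³rᵢ⁴ ≲ δ³W^{3/2} + δ Y₁ W^{1/2}` up to powers of `c`). [cite: Tao2011, §10, proof of Thm. 10.1 (p. 33)] -/
theorem tao2011_Y6_chain_bound :
    ∃ C : ℝ≥0, ∀ (x₀ : ℝ³) (a b k : ℝ), 0 < a → 0 < k → a + 2 * k⁻¹ < b →
      ∀ u : ℝ³ → ℝ³, ContDiff ℝ 2 u →
        ∫⁻ y, ENNReal.ofReal (whitneyRadius x₀ a b k y) *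
            rmsE (curl u) y (whitneyRadius x₀ a b k y) ^ 3 ≤
          C * ENNReal.ofReal (Real.sqrt (2 * localisedEnstrophy (fun x => annularRamp k a b ‖x - x₀‖) u / (97 * k))) *
            (ENNReal.ofReal (k * localisedEnstrophy (fun x => annularRamp k a b ‖x - x₀‖) u) +
              ENNReal.ofReal (k⁻¹ * localisedEnstrophyDissipation (fun x => annularRamp k a b ‖x - x₀‖) u)) := by
  set V : ℝ≥0∞ := volume (ball (0 : ℝ³) 1) with hV
  have hVtop : V ≠ ⊤ := measure_ball_lt_top.ne
  set c₃ : ℝ≥0∞ := ENNReal.ofReal ((1 + 3 / 100) ^ 2 * (3 / (1 - 3 / 100)) ^ 3) with hc₃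
  set c₁₀ : ℝ≥0∞ := ENNReal.ofReal ((1 + 10 / 100) ^ 2 * (10 / (1 - 10 / 100)) ^ 3) with hc₁₀
  set X : ℝ≥0∞ := 217 * 3200 * (c₃ * V) + 40804 * 12996 * 81 * (c₁₀ * V) with hX
  have hXtop : X ≠ ⊤ := by
    rw [hX]
    exact ENNReal.add_ne_top.2 ⟨ENNReal.mul_ne_top (by norm_num) (ENNReal.mul_ne_top ENNReal.ofReal_ne_top hVtop),
      ENNReal.mul_ne_top (by norm_num) (ENNReal.mul_ne_top ENNReal.ofReal_ne_top hVtop)⟩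
  refine ⟨X.toNNReal, fun x₀ a b k ha hk hab u hu => ?_⟩
  rw [ENNReal.coe_toNNReal hXtop]
  have hℓ : 0 < k⁻¹ := inv_pos.2 hk
  set W := localisedEnstrophy (fun x => annularRamp k a b ‖x - x₀‖) u with hW
  set Y₁ := localisedEnstrophyDissipation (fun x => annularRamp k a b ‖x - x₀‖) u with hY₁
  have hW0 : 0 ≤ W := localisedEnstrophy_nonneg (fun x => annularRamp_nonneg _ _ _ _) u
  have hbong : bongConst k W = Real.sqrt (2 * W / (97 * k)) := rfl
  have hbong0 : 0 ≤ bongConst k W := Real.sqrt_nonneg _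
  set CW := ENNReal.ofReal (bongConst k W) with hCW
  have hω : Continuous (curl u) := continuous_curl (hu.of_le (by norm_num))
  -- the large region
  have hIL : ∫⁻ z in {z | (400 * k)⁻¹ ≤ whitneyRadius x₀ a b k z}, chainDensity x₀ a b k u z ≤
      3200 * (c₃ * V) * (CW * ENNReal.ofReal (k * W)) := by
    have h := lintegral_large_le (x₀ := x₀) (a := a) (b := b) hk hω
    have e1 : ENNReal.ofReal (bongConst k W * (400 * k) ^ 2) = CW * ENNReal.ofReal ((400 * k) ^ 2) :=
      ENNReal.ofReal_mul hbong0
    have e2 : ENNReal.ofReal ((400 * k) ^ 2) * ENNReal.ofReal (100 * k)⁻¹ * ENNReal.ofReal (2 * W) =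
        3200 * ENNReal.ofReal (k * W) := by
      rw [← ENNReal.ofReal_mul (by positivity), ← ENNReal.ofReal_mul (by positivity),
        show (400 * k) ^ 2 * (100 * k)⁻¹ * (2 * W) = 3200 * (k * W) by field_simp; ring,
        ENNReal.ofReal_mul (by norm_num), ENNReal.ofReal_ofNat]
    calc ∫⁻ z in {z | (400 * k)⁻¹ ≤ whitneyRadius x₀ a b k z}, chainDensity x₀ a b k u z
        ≤ ENNReal.ofReal (bongConst k W * (400 * k) ^ 2) *
            (c₃ * V * ENNReal.ofReal (100 * k)⁻¹ * ENNReal.ofReal (2 * W)) := h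
      _ = c₃ * V * CW * (ENNReal.ofReal ((400 * k) ^ 2) * ENNReal.ofReal (100 * k)⁻¹ * ENNReal.ofReal (2 * W)) := by
          rw [e1]; ring
      _ = 3200 * (c₃ * V) * (CW * ENNReal.ofReal (k * W)) := by rw [e2]; ring
  -- the overlap integral
  have hIΦ : ∫⁻ z, dissOverlap x₀ a b k u z ≤ c₁₀ * V * ENNReal.ofReal (k⁻¹ * Y₁) := by
    have h := lintegral_invSq_dissipation_le (x₀ := x₀) (a := a) (b := b) hk hu
    calc ∫⁻ z, dissOverlap x₀ a b k u z
        ≤ c₁₀ * V * ENNReal.ofReal (100 * k)⁻¹ * ENNReal.ofReal Y₁ := h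
      _ ≤ c₁₀ * V * ENNReal.ofReal k⁻¹ * ENNReal.ofReal Y₁ := by
          gcongr
          linarith
      _ = c₁₀ * V * ENNReal.ofReal (k⁻¹ * Y₁) := by
          rw [mul_assoc (c₁₀ * V), ← ENNReal.ofReal_mul hℓ.le]
  calc ∫⁻ y, ENNReal.ofReal (whitneyRadius x₀ a b k y) * rmsE (curl u) y (whitneyRadius x₀ a b k y) ^ 3
      = ∫⁻ y, chainDensity x₀ a b k u y := rfl
    _ ≤ 217 * (∫⁻ z in {z | (400 * k)⁻¹ ≤ whitneyRadius x₀ a b k z}, chainDensity x₀ a b k u z) +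
          40804 * 12996 * 81 * CW * ∫⁻ z, dissOverlap x₀ a b k u z := lintegral_chainDensity_le ha hk hab hu
    _ ≤ 217 * (3200 * (c₃ * V) * (CW * ENNReal.ofReal (k * W))) +
          40804 * 12996 * 81 * CW * (c₁₀ * V * ENNReal.ofReal (k⁻¹ * Y₁)) := by
        gcongr
    _ = 217 * 3200 * (c₃ * V) * CW * ENNReal.ofReal (k * W) +
          40804 * 12996 * 81 * (c₁₀ * V) * CW * ENNReal.ofReal (k⁻¹ * Y₁) := by ring
    _ ≤ 217 * 3200 * (c₃ * V) * CW * (ENNReal.ofReal (k * W) + ENNReal.ofReal (k⁻¹ * Y₁)) +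
          40804 * 12996 * 81 * (c₁₀ * V) * CW * (ENNReal.ofReal (k * W) + ENNReal.ofReal (k⁻¹ * Y₁)) :=
        add_le_add (mul_le_mul' le_rfl le_self_add) (mul_le_mul' le_rfl le_add_self)
    _ = X * ENNReal.ofReal (Real.sqrt (2 * W / (97 * k))) *
          (ENNReal.ofReal (k * W) + ENNReal.ofReal (k⁻¹ * Y₁)) := by
        rw [hX, ← hbong, ← hCW]; ring

end Final

end Literature.Analysis.FluidPDE

end
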